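import Literature.MathematicalPhysics.QuantumFieldTheory.Balaban1983to89.T4ObservableTelescope
import Literature.MathematicalPhysics.QuantumFieldTheory.Balaban1983to89.T4CauchySum
import Literature.MathematicalPhysics.QuantumFieldTheory.Balaban1983to89.T4VarianceMatching

/-!
# `Balaban1983to89.T4ObservableTelescopeTwoRun` — the TWO-RUN half of observable-level telescoping: the summands of the
# telescoping sum indexed by scale distance, the exact increment identity between the runs at spacings `L^{-K}` and
# `L^{-K-1}`, «final-density matching + first-step defect + defect matching ⇒ the continuum limit of the cell's
# expectations exists», (v2, §5) the FREE COMPARISON LEVEL: «one-run geometric defects + mid-level matching along a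
# schedule ⇒ the same», with no two-run comparison of defects, and (v3, §6) THE SUPPLIER SIDE OF MID-LEVEL MATCHING: the
# schedule `m(K) ≍ log K` in the kernel and the density-level venue at distance `m` from both ends (cell T4, node O3b/H2 → U5;
# bookkeeping)

HONEST FRAMING.  Audit cell `pub-balaban`, unit `b2b-balaban-t4-ne1p-p3-g2` (T⁴-continuum fan-out, PROVER seat P3 for the
spine estimate NE1′ = DRESSED STABILITY in the observable-attached format, lineage generation 2; journal row
`T4-O3.E-NE1′-PROVE-P3b*`, companion record `HOME/t4/T4-EST-NE1p-P3.md` v2; module v1 = p184698, v2 = v1 with two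
docstring corrections of the King paraphrase + §5 appended, v1 declarations otherwise unchanged; v2.1 = v2 + the
`prodLoop` citation docfix; v3 (generation 3, unit `b2b-balaban-t4-ne1p-p3-g3`, journal row `T4-O3.E-NE1′-PROVE-P3c*`,
record v3) = v2.1 with the King quotation restored to the letter (cross-read C-pv12g12-5: «T_1^{(k)}, with effective
actions S^{(k),1} and S^{(k+n),1}», capital `K`, `Z^{ε_K}`, (3.9) = the SMALL-FIELD part) + §6 appended, every v2.1
declaration statement unchanged; v3 = p185057, v3.1 = v3 + §6.4 appended (p185100), v3.2 = v3.1 + the `m = 0` slice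
`finalMatching_of_midDiscrepancyRate` + DOCFIX of XREAD C-ref6-126 V1; earlier declarations unchanged).  ASSIGNED TECHNIQUE
of the seat (unchanged):
«observable-level telescoping: write ⟨F⟩ differences as telescoping sums over scales and bound each increment by the printed
one-step contraction + the μ-derivative of the effective action».  Generation 1 (`T4ObservableTelescope`) proved the EXACT
one-run identity `⟨F⟩_ε = (∫ρ_K F + Σ_{k<K} defect_k)/∫ρ_K` and the K-UNIFORM summation lemma; this module is the row text's
SECOND half — «compare the two runs' EXPECTATIONS … each summand = (one step of run A) − (one step of run B) applied to the SAME
spectator functional, bounded by the step's first-order sensitivity times the runs' accumulated disagreement» — i.e. the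
CONVERGENCE half.  The cell's T4 target is the existence and uniqueness of the continuum limit of unit-scale averaged loop
expectations on a FINITE torus with Bałaban's densities as GIVEN data and the printed end statement (B) and the β-hypothesis
as HYPOTHESES (the prefix `T4Continuum.FiniteEpsData.UnderHypotheses`); it is NOT an infinite-volume statement, NOT a mass gap,
NOT the Clay problem, and this module is NOT progress on any summit.  Value = kernel-checked bookkeeping: WHICH three
real-number inequalities about Bałaban's runs the telescoping lane needs for EXISTENCE, typed as hypothesis shapes, and the
proof that they suffice — nothing else.  Every conditional of the cell (BetaPertH, (B), (B^μ)) is either absent (§1–§3: nothing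
there is about Bałaban's estimates) or the explicit antecedent of the prefix `UnderHypotheses` (§4); none is hidden in a
definition.

CITATION HEADER.  From T. Bałaban's series (CMP 1984–89) this module takes ONLY what the imported tree modules already quote
and model, re-used BY NAME: the order of the operations [Balaban1988Convergent] (0.2) p. 244 «ρ_k = RTρ_{k−1} = (RT)^kρ₀»
(tree `T4Continuum.Realisation.rho_succ_eq`, `T4ObservableTelescope.PrintedChain`), the normalization property
[Balaban1989LargeFieldI] (0.4) p. 176 «∫dV(Rρ)(V) = ∫dVρ(V)» (tree `Setup.PreservesIntegral`, used through
`T4ObservableTelescope.expect_comp_iter_eq_telescope`), and the «averaged loop variables» of [Balaban1989LargeFieldII]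
p. 356 — the PROGRAMME SENTENCE «physical observables, like loop variables, averaged loop variables» as typed by
`T4Continuum.FiniteEpsData.avgObs` / `scheme` (a class of observables, not a result; B16's (0.1), pp. 355–356, is the
ultraviolet-stability sandwich and is NOT used by this module — v2.1 docfix after the cell's citation register
`t4/CITED-FACTS-T4.md` v1 §4).  No page of the series was newly read for this module and no sentence is newly attributed
to it.  The PRINTED TEMPLATE of the two-run comparison is C. King, *The U(1) Higgs model. I. The
continuum limit*, Commun. Math. Phys. **102** (1986) 649–677 [King1986], read by this seat on the held text
`paper:king1986-cmp102-king-u1-higgs-i` pp. 656–657 (PDF pp. 8–9), §3.2: «Consider the model defined on the lattices T_{ε_K}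
and T_{ε_{K+n}} for some integer n. Then by applying the renormalization transformation k and k+n times respectively we
generate two models on the same unit lattice T_1^{(k)}, with effective actions S^{(k),1} and S^{(k+n),1}. The following theorem
is the core of this paper. Theorem 3.4. … (3.9)» and p. 657 «Hence {Z^{ε_K}(T_{ε_K}, g, h)} is a Cauchy sequence and converges to
a unique limit as K → ∞.» (v3: quotation restored to the letter — the comma, the superscript «,1» of the unit-lattice actions,
print's capital K and `Z^{ε_K}`; v1–v2.1 wrote «T^{(k)}_1 with effective actions S^{(k)} and S^{(k+n)}», κ, `Z_{ε_κ}`; cross-read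
C-pv12g12-5) — (3.9) bounds `χ_k(A_k, φ_k)·|S^{(k),1} − S^{(k+n),1}|`, the SMALL-FIELD PART (χ_k the small-field characteristic
function; §3.2 opens «We will use the convergence of the effective action in the small field region») of the difference of the
two runs' effective actions after k resp. k+n steps on the common unit lattice T_1^{(k)}, by `C(L^{−γk}(L^kε_K)^{−β} + (L^kε_K)^σ)|T|`
(«where 0 < γ < 1, 0 < σ, β and C depends on g, h»; the large-field remainder enters (3.10) separately), and (3.10)–(3.13) turn
this into the Cauchy property by a CHOICE of the comparison step k («Of course we are free to choose k as we like», p. 657; (3.12)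
`k = [2βK(2β+γ)^{−1}]` is LINEAR in K and (3.13) is then GEOMETRIC in K, i.e. a power of ε_K); the shape `FinalMatching` below is
the observable-level reading of such a comparison made at the END of both runs (King instead optimises an intermediate k; v1 of
this header said «final effective actions … geometric in L^{−γk}», corrected in v2), and NOTHING of the kind is printed for
Bałaban's four-dimensional densities (cell GAPS G-ne1p3-4).  NEAREST PRIOR ART for telescoping an observable (cell
literature record `t4/T4-LITERATURE.md` §1.31 (C), not re-adjudicated here): printed flows telescope ACROSS CUTOFFS (King
l.c.; Gawędzki–Kupiainen 1985 §7) or, ACROSS SCALES, as backward martingales of a continuum Polchinski flow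
(Bauerschmidt–Bodineau–Dagallier 2024, arXiv:2307.07619, §4); the present bookkeeping does both at once — scale by scale at
equal scale DISTANCE between two cutoffs — and is [folklore] arithmetic; the per-step SIZES it asks for are NOT PRINTED.
ABSOLUTE RULE honoured: no programme-internal statement is a hypothesis-free input; §1–§2 are over abstract carriers / bare real
sequences, §3–§4 instantiate them on the cell's data type `T4Continuum.FiniteEpsData` using only its fields and the two named
hypotheses `AvgMeasurable` (measurability of the printed averaging formulas) and the prefix `UnderHypotheses`.

WHAT IS PROVED (all [folklore] bookkeeping; no `sorry`, no new axiom):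
§1 THE SUMMANDS.  `distDefect av Tρ R K f n` = the ℝ-defect of the weight `f` (level `K`) pulled back to the step at SCALE
   DISTANCE `n` from the observable (`n = 0` is the last step `K−1 → K`), by the same cast-free recursion as generation 1's
   `telescopeSum`; `telescopeSum K f = Σ_{n<K} distDefect K f n` (`telescopeSum_eq_sum_distDefect`); generation 1's recursive
   size predicate `DefectBoundedBy a K f` IS `∀ n < K, |distDefect K f n| ≤ a (K−1−n)` (`defectBoundedBy_iff_distDefect`); sizes
   geometric in the distance sum K-uniformly (`abs_telescopeSum_le_of_distLE`, `sum_range_mul_pow_le`); every summand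
   vanishes along weakly invisible R-steps (`distDefect_eq_zero_of_weaklyInvisible`).
§2 THE TWO-RUN ARITHMETIC (bare real sequences).  If `E K = A K + Σ_{n<K} u K n` for every `K` (run `K`'s expectation = its
   final-density expectation + its normalised defects), then EXACTLY
   `E (K+1) − E K = [A (K+1) − A K] + u (K+1) K + Σ_{n<K} [u (K+1) n − u K n]` (`increment_eq`): final-density mismatch + the
   longer run's extra (first, farthest) step + the DIFFERENCES OF PARTNER DEFECTS at equal scale distance — the row text's
   «(one step of run A) − (one step of run B) applied to the SAME spectator functional».  Hence summable majorants `b`, `c`, `w`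
   of the three pieces give summable increments (`abs_increment_le`, `summable_increments_of_twoRun`) and a limit
   (`exists_tendsto_of_twoRun`).  The quantitative currency of the third piece: `deltaAt E ρ inj K k` = the cell's transported
   injected discrepancy (`T4CauchySum.delta`, nodes U1–U4) ACCUMULATED AT LEVEL `k` (`deltaAt_self : deltaAt … K K = delta … K`,
   `deltaAt_le : ≤ E·C·(K+1)^{c+1}·max(θ,ρ)^k` under `T4CauchySum.InjectedRate`); if the partner defects at distance `n` differ
   by at most `S·r^n·deltaAt … K (K−n)` («sensitivity × accumulated disagreement») then
   `Σ_{n<K} |u (K+1) n − u K n| ≤ S·E·C·(K+1)^{c+2}·q^K`, `q = max(r, θ, ρ)` (`sum_abs_sub_le_of_sensitivity`), summable in `K`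
   when `r, θ, ρ < 1` (`summable_sensitivityMajorant`).
§3 THE CELL'S DATA.  For `D : T4Continuum.FiniteEpsData F G`, bare couplings `g₀ : ℕ → ℝ` and a string of loop labels `Cs`:
   `finalExpect D g₀ K Cs` = the expectation of the plain loop product `prodLoop K Cs` in run `K`'s FINAL density `ρ_K^{(K)}` on
   the unit lattice; `normDefect D g₀ K Cs n` = run `K`'s ℝ-defect at distance `n` of the pulled-back loop product, divided by
   `∫ρ_K^{(K)}`; UNCONDITIONALLY (given `D.AvgMeasurable`)
   `(D.scheme g₀).expectAt K Cs = finalExpect D g₀ K Cs + Σ_{n<K} normDefect D g₀ K Cs n` (`expectAt_eq_finalExpect_add_sum`, from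
   generation 1's `expect_comp_iter_eq_telescope`); the one-run K-uniform seam in this currency
   (`abs_expectAt_sub_finalExpect_le`) and the bridge from generation 1's `DefectBoundedBy` sizes
   (`uniformGeomDefect_of_defectBoundedBy`); the O3-alt collapse (`normDefect_eq_zero_of_invisible`: under the tree's
   UNPRINTED `RWeaklyInvisible` every normalised defect is zero — then the lane needs `FinalMatching` alone,
   `twoRunTelescopeData_of_invisible`).
§4 THE LANE'S EXISTENCE THEOREM.  HYPOTHESIS SHAPES (real-number statements about Bałaban's runs; NOT PRINTED, NOT proved,
   never asserted): `FinalMatching D g₀` (per string, summable `|finalExpect (K+1) − finalExpect K|` — the UNDRESSED two-run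
   matching of the final densities as seen by bounded unit-lattice loop products; King's (3.9) is its printed d = 3 abelian
   template; cell node U5 at source strength 0), `FirstDefectSummable D g₀` (the longer run's first-step defect is summable in
   `K`; implied by the K-uniform NE1′-telescoping output `UniformGeomDefect`, `firstDefectSummable_of_uniformGeomDefect`),
   `DefectMatching D g₀` (per string, `Σ_{n<K} |normDefect (K+1) n − normDefect K n|` summable in `K` — THE LANE'S TWO-RUN
   MISSING INEQUALITY; its quantitative supplier shape `DefectSensitivity` feeds it through §2, `defectMatching_of_sensitivity`).
   THEOREM `hasContinuumLimit_of_twoRun`: the three shapes ⇒ `Missing.HasContinuumLimit (D.scheme g₀)` (via the NE7 lane's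
   spine top `T4VarianceMatching.hasContinuumLimit_of_summable_increments`, used BY NAME); under the cell's prefix with the
   β-hypothesis `BetaPertHyp` explicit, the typed targets follow: `ym4_torus_continuum_limit_exists_of_twoRun`,
   `ym4_torus_continuum_limit_unique_of_twoRun` (and the print-faithful primed pair).
§5 (v2) THE COMPARISON LEVEL IS FREE (King p. 657 «Of course we are free to choose k as we like», (3.12), transplanted to the
   observable).  `midIntegral av ρ K f m` = `∫ρ_{K−m} f^{(m)}`, the weight pulled back `m` levels against the SAME chain's
   density at level `K−m` (cast-free recursion; `m = 0` final, `m = K` initial: `midIntegral_zero_right`, `midIntegral_self`);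
   THE PARTIAL TELESCOPING IDENTITY `∫ρ₀ f(Ū^K) = ∫ρ_{K−m} f^{(m)} + Σ_{m≤n<K} distDefect K f n`
   (`integral_zero_mul_comp_iter_eq_mid`: only the FAR defects separate the expectation from the mid-level evaluation) and
   NEAR DEFECTS `∫ρ_{K−m} f^{(m)} = ∫ρ_K f + Σ_{n<m} distDefect K f n` (`midIntegral_eq_integral_add_sum`); far tails under
   geometric sizes `≤ C·r^m/(1−r)` (`abs_sum_Ico_le_of_geom`).  For the cell: `midExpect D g₀ K Cs m` (normalised mid-level
   expectation; `midExpect_zero = finalExpect`, `midExpect_self = expectAt` — the costume end), the decomposition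
   `expectAt K = midExpect K m + Σ_{m≤n<K} normDefect K n` for every `m ≤ K` (`expectAt_eq_midExpect_add_sum`, unconditional
   given `AvgMeasurable`).  HYPOTHESIS SHAPE `MidMatching D g₀`: per string and per ratio `r < 1`, a schedule `m K ≤ K` with
   `Σ r^{m K} < ∞` along which the two runs' mid-level expectations AT EQUAL DISTANCE `m K` FROM THEIR ENDS match summably
   (NOT PRINTED; `m ≡ 0` excluded, `m K = K` is the Cauchy property itself — the content is in between).  THEOREM
   `hasContinuumLimit_of_midMatching`: `UniformGeomDefect ∧ MidMatching ⇒ HasContinuumLimit (D.scheme g₀)` —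
   `|⟨∏⟩_{K+1} − ⟨∏⟩_K| ≤ b K + 2C·r^{m K}/(1−r)`; NO two-run comparison of defects (`DefectMatching`) is needed on this route;
   targets `ym4_torus_continuum_limit_exists_of_midMatching` / `…unique_of_midMatching` (+ primed pair) under the prefix.
§6 (v3) THE SUPPLIER SIDE OF `MidMatching`.  (6.0) `pullback av k m f` — the weight pulled back `m` levels to a FIXED level `k`
   (cast-free recursion on `m`), with `midIntegral av ρ (k+m) f m = ∫ρ_k·(pullback av k m f)` (`midIntegral_add_eq`): the
   mid-level numerator of a run of length `k + m` at distance `m` from its end IS a level-`k` integral; for the cell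
   `midExpect (k+m) m = ∫ρ_k^{(k+m)}·W / ∫ρ_k^{(k+m)}` with `W` the pulled-back loop product (`midExpect_add_eq'`; the total
   integral is level-independent, `integral_rho_level_eq`, (0.4)).  (6.1) THE SCHEDULE LEMMA `exists_schedule`, pure real
   analysis in the kernel: for all `0 ≤ r < 1`, `0 ≤ q < 1`, `Λ ≥ 1`, `d` there is `m K ≤ K` with `Σ_K r^{m K} < ∞` AND
   `Σ_K (K+1)^d·Λ^{m K}·q^{K − m K} < ∞` (`m K = min K (t·⌊log₂(K+2)⌋)`; elementary, via `Nat.log`).  (6.2) HYPOTHESIS SHAPE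
   `MidDiscrepancyRate D g₀ Λ E ρ inj` (NOT PRINTED): `|midExpect (K+1) m − midExpect K m| ≤ V·Λ^m·deltaAt E ρ inj K (K−m)` for
   all `m ≤ K` — volume `Λ^m` of the comparison lattice times the injected discrepancy accumulated at level `K − m` (§2) —
   and THE BALANCE IN THE KERNEL `midMatching_of_midDiscrepancyRate`: under `T4CauchySum.InjectedRate C c θ inj` with
   `θ, ρ ∈ [0,1[`, `0 ≤ E`, `1 ≤ Λ`, `MidDiscrepancyRate ⇒ MidMatching` (record v2 §6 (6e), formerly [analysis], now a
   theorem); `hasContinuumLimit_of_midDiscrepancyRate`, bundle `MidRateTelescopeData`, targets `…_of_midRate` under the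
   prefix.  (6.3) THE DENSITY-LEVEL VENUE: `IsNormLaw p A μ` (a normalised level law in the push-forward reading, cf.
   `Setup.IsRT`; a probability measure, `IsNormLaw.isProbabilityMeasure`; canonical inhabitant `normLaw` for measurable
   `p ≥ 0`, `isNormLaw_normLaw`), the RELOCATION INTERFACE `MidRelocation D Cs k m` = the record's question (Q-av) made a
   field (a measurable identification `ι` of run `k+1+m`'s level-`(k+1)` fields with run `k+m`'s level-`k` fields under which
   the two pulled-back loop products are ONE function; no instance asserted), the pairing
   `abs_midExpect_sub_le_of_goodBad`: relocation + the two normalised level laws + a good/bad density datum `μ' = g·μ`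
   (`T4VarianceMatching` §5 lemmas by name) ⇒ `|midExpect (k+1+m) m − midExpect (k+m) m| ≤ s + w + w'`, the bundled
   density-level shape `MidGoodBadRate` (NOT PRINTED) with `MidGoodBadRate ⇒ MidDiscrepancyRate`
   (`midDiscrepancyRate_of_goodBad`) and `hasContinuumLimit_of_goodBad`.  (6.4, v3.1) (Q-av) REDUCED TO A SCALE LADDER:
   `ScaleLadder P P' av av'` (level-wise measurable identifications `ι j j'`, `j' = j+1`, INTERTWINING the averagings,
   `avg_j ∘ ι_{j,j'} = ι_{j+1,j'+1} ∘ avg'_{j'}`; equation-indexed, cast-free), `ScaleLadder.pullback_eq` (weights agreeing at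
   the top have pullbacks agreeing at the bottom), `RunLadder D` (a ladder for every pair of consecutive runs + unit-level
   loop compatibility `loop`), `RunLadder.midRelocation : MidRelocation D Cs k m` for ALL `(Cs, k, m)`, the shape
   `LadderGoodBadRate` (the good/bad datum along a given ladder) with `⇒ MidGoodBadRate` and `hasContinuumLimit_of_ladder`.
   Net effect of v3/v3.1: along the free-level route the lane's two-run input is REDUCED to a density-level statement at ONE
   level `k = K − m` — the cell's undressed U5 matching in (L^∞, L¹) currency with explicit volume `Λ^m` and rate
   `deltaAt … K k` — plus level-homogeneity in ladder form; the log-schedule arithmetic is no longer an [analysis] remark.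
WHAT IS NOT PROVED.  None of the shapes (`FinalMatching`, `DefectMatching`/`DefectSensitivity`, `UniformGeomDefect`,
`MidMatching`, `MidDiscrepancyRate`, `MidGoodBadRate`, `LadderGoodBadRate`) for Bałaban's densities, and no instance of
`MidRelocation` / `ScaleLadder` / `RunLadder` (the cell's data type `T4Continuum.FiniteEpsData` keeps every run's averagings
and loop representatives free, level by level, and
records neither nonnegativity nor measurability of the intermediate densities — whence `IsNormLaw` is a hypothesis on a
supplied measure, not a construction); no size of any defect; no identification of the two
runs' averaging operations at equal scale distance (the cell's data type keeps `D.av (K+1) (k+1)` and `D.av K k` on different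
lattices `GaugeField (F.P (K+1)) (k+1) G` / `GaugeField (F.P K) k G`; any SUPPLIER of `DefectMatching` must relate them — a
question put to the carver in the record, §6 (Q-av)); NE1′ itself; anything about (B), (B^μ) or the β-functions.  STRUCTURAL
FINDING for the carver (record §6): along this lane EXISTENCE needs no generating function, no holomorphy and no dressed
(source-carrying) density — the source enters only through the fixed bounded weight `prodLoop`; what it needs is EITHER
(§4, comparison at the end) the per-step two-run comparison `DefectMatching`, whose natural supplier needs the SAME
first-order conditional-mean channel as generation 1's `CondMeanGap` (GAPS G-ne1p3-1) plus a two-run comparison of the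
small-field insert laws at equal scale distance (GAPS G-ne1p3-3), OR (§5, comparison at a free distance `m(K) → ∞`) ONLY the
one-run K-uniform sizes `UniformGeomDefect` (= NE1′ in the lane's currency, G-ne1p3-1 + the cell's count) plus the UNDRESSED
matching of the two runs' densities at distance `m(K)` from their ends against the pulled-back loop product (`MidMatching`,
node U5 at an intermediate level; GAPS G-ne1p3-4 re-scoped) — on the second route the two-run defect comparison disappears,
at the price that the mid-level densities live on `L^{4m(K)}` unit cubes (the supplier balances this volume against the far
tail `r^{m(K)}`, e.g. `m(K) ≍ log K`; [analysis], record §6).  Neither shape is printed for Bałaban's densities.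
-/

noncomputable section

open MeasureTheory Filter Topology
open scoped BigOperators

namespace Literature.MathematicalPhysics.QuantumFieldTheory.Balaban1983to89.T4ObservableTelescopeTwoRun

open T4ObservableTelescope T4Spectator

/-! ## §1 The summands of the telescoping sum, indexed by the scale distance to the observable -/

section Summands

variable {P : Params} {G : Type*} [GaugeGroup G] [MeasurableSpace G] [HaarData G]

/-- THE SUMMAND AT SCALE DISTANCE `n` of generation 1's `telescopeSum K f`: the ℝ-defect at the step `K−1−n → K−n` of the
weight `f` pulled back from level `K` — by recursion on `K`, `distDefect (K+1) f 0 = defect (Tρ K) (R K) f` (the last step) and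
`distDefect (K+1) f (n+1) = distDefect K (f ∘ avg_K) n`; zero when `n ≥ K`. [folklore] -/
def distDefect (av : ∀ j, Averaging P j G) (Tρ : (k : ℕ) → Density P (k + 1) G)
    (R : (k : ℕ) → Density P (k + 1) G → Density P (k + 1) G) : (K : ℕ) → (GaugeField P K G → ℝ) → ℕ → ℝ
  | 0, _, _ => 0
  | K + 1, f, 0 => defect (Tρ K) (R K) f
  | K + 1, f, n + 1 => distDefect av Tρ R K (fun U => f ((av K).avg U)) n

variable (av : ∀ j, Averaging P j G) (Tρ : (k : ℕ) → Density P (k + 1) G)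
  (R : (k : ℕ) → Density P (k + 1) G → Density P (k + 1) G)

/-- No step, no summand. [folklore] -/
theorem distDefect_zero_left (f : GaugeField P 0 G → ℝ) (n : ℕ) : distDefect av Tρ R 0 f n = 0 := rfl

/-- Distance `0` is the last step. [folklore] -/
theorem distDefect_succ_zero (K : ℕ) (f : GaugeField P (K + 1) G → ℝ) :
    distDefect av Tρ R (K + 1) f 0 = defect (Tρ K) (R K) f := rfl

/-- Distance `n+1` from level `K+1` is distance `n` from level `K` for the pulled-back weight. [folklore] -/
theorem distDefect_succ_succ (K : ℕ) (f : GaugeField P (K + 1) G → ℝ) (n : ℕ) :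
    distDefect av Tρ R (K + 1) f (n + 1) = distDefect av Tρ R K (fun U => f ((av K).avg U)) n := rfl

/-- Beyond the run there is nothing: `distDefect K f n = 0` for `K ≤ n`. [folklore] -/
theorem distDefect_eq_zero_of_le :
    ∀ (K : ℕ) (f : GaugeField P K G → ℝ) (n : ℕ), K ≤ n → distDefect av Tρ R K f n = 0
  | 0, _, _, _ => rfl
  | K + 1, _, 0, h => absurd h (Nat.not_succ_le_zero K)
  | K + 1, f, n + 1, h =>
    distDefect_eq_zero_of_le K (fun U => f ((av K).avg U)) n (Nat.le_of_succ_le_succ h)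

/-- Along WEAKLY INVISIBLE R-steps (generation 1's hypothesis shape; measurable averagings) every summand of a bounded
measurable weight vanishes — the O3-alt collapse, summand by summand. [folklore] -/
theorem distDefect_eq_zero_of_weaklyInvisible (hav : ∀ j, Measurable (av j).avg) :
    ∀ (K : ℕ), WeaklyInvisible Tρ R K → ∀ (f : GaugeField P K G → ℝ), Measurable f → (∃ C : ℝ, ∀ V, |f V| ≤ C) →
      ∀ n : ℕ, distDefect av Tρ R K f n = 0
  | 0, _, _, _, _, _ => rfl
  | K + 1, hW, f, hf, hfb, 0 =>
    show defect (Tρ K) (R K) f = 0 from defect_eq_zero_of_integral_eq (hW K (Nat.lt_succ_self K) f hf hfb)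
  | K + 1, hW, f, hf, hfb, n + 1 => by
    obtain ⟨C, hC⟩ := hfb
    exact distDefect_eq_zero_of_weaklyInvisible hav K (fun k hk => hW k (Nat.lt_succ_of_lt hk))
      (fun U => f ((av K).avg U)) (hf.comp (hav K)) ⟨C, fun U => hC _⟩ n

/-- **THE TELESCOPING SUM IS THE SUM OF ITS DISTANCE-INDEXED SUMMANDS**:
`telescopeSum K f = Σ_{n<K} distDefect K f n`. [folklore] -/
theorem telescopeSum_eq_sum_distDefect :
    ∀ (K : ℕ) (f : GaugeField P K G → ℝ),
      telescopeSum av Tρ R K f = ∑ n ∈ Finset.range K, distDefect av Tρ R K f n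
  | 0, f => by rw [telescopeSum_zero, Finset.sum_range_zero]
  | K + 1, f => by
    rw [telescopeSum_succ, Finset.sum_range_succ', telescopeSum_eq_sum_distDefect K]
    rfl

/-- Generation 1's recursive size predicate, unfolded: `DefectBoundedBy a K f ↔ ∀ n < K, |distDefect K f n| ≤ a (K−1−n)`
(`a` is indexed by the STEP `k = K−1−n`). [folklore] -/
theorem defectBoundedBy_iff_distDefect (a : ℕ → ℝ) :
    ∀ (K : ℕ) (f : GaugeField P K G → ℝ),
      DefectBoundedBy av Tρ R a K f ↔ ∀ n, n < K → |distDefect av Tρ R K f n| ≤ a (K - 1 - n)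
  | 0, f => by
    refine ⟨fun _ n hn => absurd hn (Nat.not_lt_zero n), fun _ => ?_⟩
    exact defectBoundedBy_zero av Tρ R a f
  | K + 1, f => by
    rw [defectBoundedBy_succ, defectBoundedBy_iff_distDefect a K]
    constructor
    · rintro ⟨h1, h2⟩ n hn
      rcases n with _ | n
      · have e : K + 1 - 1 - 0 = K := by omega
        rw [e]
        exact h2
      · have e : K + 1 - 1 - (n + 1) = K - 1 - n := by omega
        rw [e]
        exact h1 n (by omega)
    · intro h
      refine ⟨fun n hn => ?_, ?_⟩
      · have h' := h (n + 1) (by omega)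
        have e : K + 1 - 1 - (n + 1) = K - 1 - n := by omega
        rw [e] at h'
        exact h'
      · have h' := h 0 (Nat.succ_pos K)
        have e : K + 1 - 1 - 0 = K := by omega
        rw [e] at h'
        exact h'

/-- HYPOTHESIS SHAPE (per-step sizes in the distance currency): `|distDefect K f n| ≤ a n` for every `n < K`. [folklore] -/
def DistDefectLE (K : ℕ) (f : GaugeField P K G → ℝ) (a : ℕ → ℝ) : Prop :=
  ∀ n, n < K → |distDefect av Tρ R K f n| ≤ a n

/-- Sizes add up: `|telescopeSum K f| ≤ Σ_{n<K} a n`. [folklore] -/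
theorem abs_telescopeSum_le_of_distLE {K : ℕ} {f : GaugeField P K G → ℝ} {a : ℕ → ℝ}
    (h : DistDefectLE av Tρ R K f a) : |telescopeSum av Tρ R K f| ≤ ∑ n ∈ Finset.range K, a n := by
  rw [telescopeSum_eq_sum_distDefect]
  exact (Finset.abs_sum_le_sum_abs _ _).trans (Finset.sum_le_sum fun n hn => h n (Finset.mem_range.1 hn))

/-- `Σ_{n<K} C·r^n ≤ C/(1 − r)` for `0 ≤ C`, `0 ≤ r < 1` — the K-uniformity of geometric sizes in the distance. [folklore] -/
theorem sum_range_mul_pow_le {C r : ℝ} (hC : 0 ≤ C) (hr0 : 0 ≤ r) (hr1 : r < 1) (K : ℕ) :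
    ∑ n ∈ Finset.range K, C * r ^ n ≤ C / (1 - r) := by
  have hs : ∑ n ∈ Finset.range K, r ^ n ≤ (1 - r)⁻¹ :=
    sum_le_hasSum (Finset.range K) (fun n _ => pow_nonneg hr0 n) (hasSum_geometric_of_lt_one hr0 hr1)
  rw [← Finset.mul_sum, div_eq_mul_inv]
  exact mul_le_mul_of_nonneg_left hs hC

/-- Geometric sizes in the distance give `|telescopeSum K f| ≤ C/(1−r)` UNIFORMLY IN `K` (generation 1's
`abs_telescopeSum_le_of_geometric` in the distance currency). [folklore] -/
theorem abs_telescopeSum_le_of_distGeom {K : ℕ} {f : GaugeField P K G → ℝ} {C r : ℝ} (hC : 0 ≤ C) (hr0 : 0 ≤ r)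
    (hr1 : r < 1) (h : DistDefectLE av Tρ R K f fun n => C * r ^ n) : |telescopeSum av Tρ R K f| ≤ C / (1 - r) :=
  (abs_telescopeSum_le_of_distLE av Tρ R h).trans (sum_range_mul_pow_le hC hr0 hr1 K)

end Summands

/-! ## §2 The two-run arithmetic: the exact increment identity and its summable majorants (bare real sequences) -/

section TwoRun

/-- **THE INCREMENT IDENTITY.**  If run `K`'s expectation decomposes as `E K = A K + Σ_{n<K} u K n` (final-density
expectation + defects indexed by scale distance), then between consecutive runs
`E (K+1) − E K = [A (K+1) − A K] + u (K+1) K + Σ_{n<K} [u (K+1) n − u K n]`: final-density mismatch, the longer run's extra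
(farthest) step, and the differences of the PARTNER defects at equal scale distance. [folklore] -/
theorem increment_eq {E A : ℕ → ℝ} {u : ℕ → ℕ → ℝ} (hE : ∀ K, E K = A K + ∑ n ∈ Finset.range K, u K n) (K : ℕ) :
    E (K + 1) - E K
      = (A (K + 1) - A K) + u (K + 1) K + ∑ n ∈ Finset.range K, (u (K + 1) n - u K n) := by
  rw [hE (K + 1), hE K, Finset.sum_range_succ, Finset.sum_sub_distrib]
  ring

/-- Majorants of the three pieces bound the increment. [folklore] -/
theorem abs_increment_le {E A : ℕ → ℝ} {u : ℕ → ℕ → ℝ} (hE : ∀ K, E K = A K + ∑ n ∈ Finset.range K, u K n)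
    {K : ℕ} {b c w : ℝ} (hA : |A (K + 1) - A K| ≤ b) (hc : |u (K + 1) K| ≤ c)
    (hw : ∑ n ∈ Finset.range K, |u (K + 1) n - u K n| ≤ w) : |E (K + 1) - E K| ≤ b + c + w := by
  rw [increment_eq hE K]
  calc |A (K + 1) - A K + u (K + 1) K + ∑ n ∈ Finset.range K, (u (K + 1) n - u K n)|
      ≤ |A (K + 1) - A K + u (K + 1) K| + |∑ n ∈ Finset.range K, (u (K + 1) n - u K n)| := abs_add_le _ _
    _ ≤ (|A (K + 1) - A K| + |u (K + 1) K|) + ∑ n ∈ Finset.range K, |u (K + 1) n - u K n| :=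
        add_le_add (abs_add_le _ _) (Finset.abs_sum_le_sum_abs _ _)
    _ ≤ b + c + w := by linarith

/-- **SUMMABLE MAJORANTS ⇒ SUMMABLE INCREMENTS.** [folklore] -/
theorem summable_increments_of_twoRun {E A : ℕ → ℝ} {u : ℕ → ℕ → ℝ}
    (hE : ∀ K, E K = A K + ∑ n ∈ Finset.range K, u K n) {b c w : ℕ → ℝ} (hb : Summable b) (hc : Summable c)
    (hw : Summable w) (hA : ∀ K, |A (K + 1) - A K| ≤ b K) (hcK : ∀ K, |u (K + 1) K| ≤ c K)
    (hwK : ∀ K, ∑ n ∈ Finset.range K, |u (K + 1) n - u K n| ≤ w K) :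
    ∃ d : ℕ → ℝ, Summable d ∧ ∀ K, |E (K + 1) - E K| ≤ d K :=
  ⟨fun K => b K + c K + w K, (hb.add hc).add hw, fun K => abs_increment_le hE (hA K) (hcK K) (hwK K)⟩

/-- … hence the expectations converge along the full sequence of runs. [folklore] -/
theorem exists_tendsto_of_twoRun {E A : ℕ → ℝ} {u : ℕ → ℕ → ℝ}
    (hE : ∀ K, E K = A K + ∑ n ∈ Finset.range K, u K n) {b c w : ℕ → ℝ} (hb : Summable b) (hc : Summable c)
    (hw : Summable w) (hA : ∀ K, |A (K + 1) - A K| ≤ b K) (hcK : ∀ K, |u (K + 1) K| ≤ c K)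
    (hwK : ∀ K, ∑ n ∈ Finset.range K, |u (K + 1) n - u K n| ≤ w K) : ∃ l : ℝ, Tendsto E atTop (𝓝 l) := by
  obtain ⟨d, hd, hdK⟩ := summable_increments_of_twoRun hE hb hc hw hA hcK hwK
  exact cauchySeq_tendsto_of_complete
    (cauchySeq_of_dist_le_of_summable d (fun K => by rw [Real.dist_eq, abs_sub_comm]; exact hdK K) hd)

/-- The extra step of the longer run is its FIRST step, at distance `K` from the observable: a distance-uniform size bound
covers it. [folklore] -/
theorem abs_first_le_of_uniform {u : ℕ → ℕ → ℝ} {a : ℕ → ℝ} (hu : ∀ K n, n < K → |u K n| ≤ a n) (K : ℕ) :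
    |u (K + 1) K| ≤ a K :=
  hu (K + 1) K (Nat.lt_succ_self K)

/-! ### The currency of the partner-defect differences: the transported discrepancy accumulated at an intermediate level -/

open T4CauchySum Finset

/-- THE TRANSPORTED INJECTED DISCREPANCY OF THE PAIR OF RUNS `(K, K+1)` ACCUMULATED AT LEVEL `k`:
`deltaAt E ρ inj K k = E · Σ_{(j,m) ∈ antidiagonal k} inj K j · ρ^m` — the cell's `T4CauchySum.delta` (nodes U1–U4: discrepancy
`inj K j` injected at scale `j`, contracted by `ρ` per subsequent scale) stopped at level `k ≤ K` instead of the unit lattice.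
A definition; which `inj`, `ρ` Bałaban's runs admit is the cell's NE2–NE6, not touched here. [folklore] -/
def deltaAt (E ρ : ℝ) (inj : ℕ → ℕ → ℝ) (K k : ℕ) : ℝ :=
  E * ∑ p ∈ antidiagonal k, inj K p.1 * ρ ^ p.2

/-- At the unit lattice it is the cell's transported total. [folklore] -/
theorem deltaAt_self (E ρ : ℝ) (inj : ℕ → ℕ → ℝ) (K : ℕ) : deltaAt E ρ inj K K = delta E ρ inj K := rfl

/-- Nonnegativity under an injected rate. [folklore] -/
theorem deltaAt_nonneg {C θ E ρ : ℝ} {c : ℕ} {inj : ℕ → ℕ → ℝ} (hinj : InjectedRate C c θ inj) (hE : 0 ≤ E)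
    (hρ : 0 ≤ ρ) {K k : ℕ} (hk : k ≤ K) : 0 ≤ deltaAt E ρ inj K k := by
  unfold deltaAt
  refine mul_nonneg hE (Finset.sum_nonneg fun p hp => ?_)
  have hj : p.1 ≤ K := by have := mem_antidiagonal.mp hp; omega
  exact mul_nonneg (hinj K p.1 hj).1 (pow_nonneg hρ _)

/-- **`deltaAt E ρ inj K k ≤ E·C·(K+1)^{c+1}·max(θ,ρ)^k`** under an injected rate `C (K+1)^c θ^j` (the cell's Cauchy-sum
estimate `T4CauchySum.delta_le`, stopped at level `k`). [folklore] -/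
theorem deltaAt_le {C θ E ρ : ℝ} {c : ℕ} {inj : ℕ → ℕ → ℝ} (hinj : InjectedRate C c θ inj) (hE : 0 ≤ E)
    (hθ : 0 ≤ θ) (hρ : 0 ≤ ρ) {K k : ℕ} (hk : k ≤ K) :
    deltaAt E ρ inj K k ≤ E * C * ((K : ℝ) + 1) ^ (c + 1) * (max θ ρ) ^ k := by
  unfold deltaAt
  have hC : 0 ≤ C * ((K : ℝ) + 1) ^ c := hinj.const_nonneg K
  have hsum : ∑ p ∈ antidiagonal k, inj K p.1 * ρ ^ p.2
      ≤ ∑ p ∈ antidiagonal k, C * ((K : ℝ) + 1) ^ c * (θ ^ p.1 * ρ ^ p.2) := by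
    refine Finset.sum_le_sum fun p hp => ?_
    have hj : p.1 ≤ K := by have := mem_antidiagonal.mp hp; omega
    calc inj K p.1 * ρ ^ p.2 ≤ (C * ((K : ℝ) + 1) ^ c * θ ^ p.1) * ρ ^ p.2 :=
          mul_le_mul_of_nonneg_right (hinj K p.1 hj).2 (pow_nonneg hρ _)
      _ = C * ((K : ℝ) + 1) ^ c * (θ ^ p.1 * ρ ^ p.2) := by ring
  have hk1 : (k : ℝ) + 1 ≤ (K : ℝ) + 1 := by exact_mod_cast Nat.succ_le_succ hk
  have hq0 : 0 ≤ max θ ρ := hθ.trans (le_max_left θ ρ)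
  calc E * ∑ p ∈ antidiagonal k, inj K p.1 * ρ ^ p.2
      ≤ E * ∑ p ∈ antidiagonal k, C * ((K : ℝ) + 1) ^ c * (θ ^ p.1 * ρ ^ p.2) :=
        mul_le_mul_of_nonneg_left hsum hE
    _ = E * (C * ((K : ℝ) + 1) ^ c * ∑ p ∈ antidiagonal k, θ ^ p.1 * ρ ^ p.2) := by
        congr 1
        rw [Finset.mul_sum]
    _ ≤ E * (C * ((K : ℝ) + 1) ^ c * (((k : ℝ) + 1) * (max θ ρ) ^ k)) :=
        mul_le_mul_of_nonneg_left (mul_le_mul_of_nonneg_left (sum_antidiagonal_pow_mul_pow_le hθ hρ k) hC) hE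
    _ ≤ E * (C * ((K : ℝ) + 1) ^ c * (((K : ℝ) + 1) * (max θ ρ) ^ k)) :=
        mul_le_mul_of_nonneg_left
          (mul_le_mul_of_nonneg_left (mul_le_mul_of_nonneg_right hk1 (pow_nonneg hq0 k)) hC) hE
    _ = E * C * ((K : ℝ) + 1) ^ (c + 1) * (max θ ρ) ^ k := by ring

/-- **SENSITIVITY × ACCUMULATED DISAGREEMENT SUMS TO A SUMMABLE MAJORANT.**  If the partner defects at distance `n < K` differ by
at most `S·r^n·deltaAt E ρ inj K (K−n)` (the spectator weight's first-order sensitivity, geometric in the distance, times the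
runs' discrepancy accumulated at the level where the step acts), then
`Σ_{n<K} |u (K+1) n − u K n| ≤ S·E·C·(K+1)^{c+2}·q^K` with `q = max(r, max(θ, ρ))`. [folklore] -/
theorem sum_abs_sub_le_of_sensitivity {u : ℕ → ℕ → ℝ} {S E C θ ρ r : ℝ} {c : ℕ} {inj : ℕ → ℕ → ℝ}
    (hinj : InjectedRate C c θ inj) (hS : 0 ≤ S) (hE : 0 ≤ E) (hθ : 0 ≤ θ) (hρ : 0 ≤ ρ) (hr : 0 ≤ r)
    (h : ∀ K n, n < K → |u (K + 1) n - u K n| ≤ S * r ^ n * deltaAt E ρ inj K (K - n)) (K : ℕ) :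
    ∑ n ∈ Finset.range K, |u (K + 1) n - u K n|
      ≤ S * E * C * ((K : ℝ) + 1) ^ (c + 2) * (max r (max θ ρ)) ^ K := by
  set q := max r (max θ ρ) with hq
  have hq0 : 0 ≤ q := hr.trans (le_max_left _ _)
  have hrq : r ≤ q := le_max_left _ _
  have h1q : max θ ρ ≤ q := le_max_right _ _
  have hq10 : 0 ≤ max θ ρ := hθ.trans (le_max_left θ ρ)
  have hC : 0 ≤ C := by simpa using hinj.const_nonneg 0
  set M := S * (E * C * ((K : ℝ) + 1) ^ (c + 1)) * q ^ K with hM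
  have hM0 : 0 ≤ M :=
    mul_nonneg (mul_nonneg hS (mul_nonneg (mul_nonneg hE hC) (pow_nonneg (by positivity) _))) (pow_nonneg hq0 K)
  have hterm : ∀ n ∈ Finset.range K, |u (K + 1) n - u K n| ≤ M := by
    intro n hn
    have hnK : n < K := Finset.mem_range.1 hn
    have hδ := deltaAt_le hinj hE hθ hρ (Nat.sub_le K n)
    have hδ0 := deltaAt_nonneg hinj hE hρ (Nat.sub_le K n)
    calc |u (K + 1) n - u K n| ≤ S * r ^ n * deltaAt E ρ inj K (K - n) := h K n hnK
      _ ≤ S * q ^ n * (E * C * ((K : ℝ) + 1) ^ (c + 1) * q ^ (K - n)) := by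
          refine mul_le_mul (mul_le_mul_of_nonneg_left (pow_le_pow_left₀ hr hrq n) hS)
            (hδ.trans (mul_le_mul_of_nonneg_left (pow_le_pow_left₀ hq10 h1q _)
              (mul_nonneg (mul_nonneg hE hC) (pow_nonneg (by positivity) _)))) hδ0
            (mul_nonneg hS (pow_nonneg hq0 n))
      _ = S * (E * C * ((K : ℝ) + 1) ^ (c + 1)) * (q ^ n * q ^ (K - n)) := by ring
      _ = M := by rw [hM, ← pow_add, Nat.add_sub_cancel' hnK.le]
  calc ∑ n ∈ Finset.range K, |u (K + 1) n - u K n| ≤ ∑ n ∈ Finset.range K, M := Finset.sum_le_sum hterm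
    _ = (K : ℝ) * M := by rw [Finset.sum_const, Finset.card_range, nsmul_eq_mul]
    _ ≤ ((K : ℝ) + 1) * M := mul_le_mul_of_nonneg_right (by linarith) hM0
    _ = S * E * C * ((K : ℝ) + 1) ^ (c + 2) * q ^ K := by rw [hM]; ring

/-- The majorant of `sum_abs_sub_le_of_sensitivity` is summable in `K` when `r, θ, ρ ∈ [0, 1[` (polynomial × geometric,
`T4CauchySum.summable_succ_pow_mul_geometric`). [folklore] -/
theorem summable_sensitivityMajorant {S E C θ ρ r : ℝ} {c : ℕ} (hθ1 : θ < 1) (hρ1 : ρ < 1) (hr : 0 ≤ r)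
    (hr1 : r < 1) :
    Summable fun K : ℕ => S * E * C * ((K : ℝ) + 1) ^ (c + 2) * (max r (max θ ρ)) ^ K := by
  have hq0 : 0 ≤ max r (max θ ρ) := hr.trans (le_max_left _ _)
  have hq1 : max r (max θ ρ) < 1 := max_lt hr1 (max_lt hθ1 hρ1)
  have := (summable_succ_pow_mul_geometric hq0 hq1 (c + 2)).mul_left (S * E * C)
  simpa [mul_assoc] using this

end TwoRun

/-! ## §3 The cell's data: expectation = final-density expectation + normalised distance-indexed defects -/

section Cell

open T4Continuum Missing

variable {F : T4Family} {G : Type*} [GaugeGroup G] [MeasurableSpace G] [HaarData G]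

/-- The plain product of the unit-lattice loop variables of a string of labels at step `K` (the weight telescoped by the
seat; `T4Spectator.measurable_prodLoop`, `abs_prodLoop_le_one`; the observables are the cell's typing of B16 p. 356's
programme sentence «loop variables, averaged loop variables» — `T4Continuum` §2 — not a printed result). [folklore] -/
def prodLoop (K : ℕ) (Cs : List (ULoop F)) (V : GaugeField (F.P K) K G) : ℝ :=
  (Cs.map fun C => loopAt V (C.1.atLevel K)).prod

/-- RUN `K`'S FINAL-DENSITY EXPECTATION of the plain loop product: `∫ρ_K^{(K)}·prodLoop / ∫ρ_K^{(K)}` on the unit lattice of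
the `K`-th torus (bare coupling `g₀ K`). [folklore] -/
def finalExpect (D : FiniteEpsData F G) (g₀ : ℕ → ℝ) (K : ℕ) (Cs : List (ULoop F)) : ℝ :=
  (∫ V, rho D K (g₀ K) K V * prodLoop K Cs V ∂fieldMeasure (F.P K) K G)
    / ∫ V, rho D K (g₀ K) K V ∂fieldMeasure (F.P K) K G

/-- RUN `K`'S NORMALISED ℝ-DEFECT AT SCALE DISTANCE `n` of the pulled-back loop product: `distDefect … K (prodLoop K Cs) n`
of the realised transforms/operations of the run `(K, g₀ K)`, divided by `∫ρ_K^{(K)}`. [folklore] -/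
def normDefect (D : FiniteEpsData F G) (g₀ : ℕ → ℝ) (K : ℕ) (Cs : List (ULoop F)) (n : ℕ) : ℝ :=
  distDefect (D.av K) (D.real.Trho K (g₀ K)) (D.real.R K (g₀ K)) K (prodLoop K Cs) n
    / ∫ V, rho D K (g₀ K) K V ∂fieldMeasure (F.P K) K G

/-- **THE DECOMPOSITION OF THE CELL'S EXPECTATIONS** (unconditional given `D.AvgMeasurable`):
`(D.scheme g₀).expectAt K Cs = finalExpect D g₀ K Cs + Σ_{n<K} normDefect D g₀ K Cs n`. [folklore] -/
theorem expectAt_eq_finalExpect_add_sum [RegularGaugeGroup G] (D : FiniteEpsData F G) (hM : D.AvgMeasurable)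
    (g₀ : ℕ → ℝ) (K : ℕ) (Cs : List (ULoop F)) :
    (D.scheme g₀).expectAt K Cs = finalExpect D g₀ K Cs + ∑ n ∈ Finset.range K, normDefect D g₀ K Cs n := by
  have h : (D.scheme g₀).expectAt K Cs
      = (∫ V, rho D K (g₀ K) K V * prodLoop K Cs V ∂fieldMeasure (F.P K) K G
            + telescopeSum (D.av K) (D.real.Trho K (g₀ K)) (D.real.R K (g₀ K)) K (prodLoop K Cs))
          / ∫ V, rho D K (g₀ K) K V ∂fieldMeasure (F.P K) K G :=
    expect_comp_iter_eq_telescope D hM K (g₀ K) (prodLoop K Cs) (measurable_prodLoop K Cs)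
      ⟨1, abs_prodLoop_le_one K Cs⟩
  rw [h, add_div, telescopeSum_eq_sum_distDefect, Finset.sum_div]
  rfl

/-- HYPOTHESIS SHAPE — THE K-UNIFORM NE1′-TELESCOPING OUTPUT in the normalised distance currency: per string, the normalised
defects are bounded by `C·r^n`, `0 ≤ r < 1`, uniformly in the run `K` (generation 1's located verdict: the sizes hoped for carry
`(θ₁φ)^n` against the count `L^{4n}`; NOT PRINTED, NOT proved — GAPS G-ne1p3-1). [folklore] -/
def UniformGeomDefect (D : FiniteEpsData F G) (g₀ : ℕ → ℝ) : Prop :=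
  ∀ Cs : List (ULoop F), ∃ C r : ℝ, 0 ≤ C ∧ 0 ≤ r ∧ r < 1 ∧
    ∀ K n, n < K → |normDefect D g₀ K Cs n| ≤ C * r ^ n

/-- THE ONE-RUN SEAM in this currency: `|⟨∏⟩_K − finalExpect K| ≤ C/(1−r)` for every `K` under `UniformGeomDefect`. [folklore] -/
theorem abs_expectAt_sub_finalExpect_le [RegularGaugeGroup G] (D : FiniteEpsData F G) (hM : D.AvgMeasurable)
    (g₀ : ℕ → ℝ) (Cs : List (ULoop F)) {C r : ℝ} (hC : 0 ≤ C) (hr0 : 0 ≤ r) (hr1 : r < 1)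
    (h : ∀ K n, n < K → |normDefect D g₀ K Cs n| ≤ C * r ^ n) (K : ℕ) :
    |(D.scheme g₀).expectAt K Cs - finalExpect D g₀ K Cs| ≤ C / (1 - r) := by
  rw [expectAt_eq_finalExpect_add_sum D hM g₀ K Cs, add_sub_cancel_left]
  exact (Finset.abs_sum_le_sum_abs _ _).trans
    ((Finset.sum_le_sum fun n hn => h K n (Finset.mem_range.1 hn)).trans (sum_range_mul_pow_le hC hr0 hr1 K))

/-- BRIDGE FROM GENERATION 1'S CURRENCY: step-indexed sizes `a k = C·r^{K−1−k}·∫ρ_K^{(K)}` in `DefectBoundedBy` give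
`UniformGeomDefect` (divide by `∫ρ_K^{(K)} > 0`, `T4Spectator.integral_rho_pos`). [folklore] -/
theorem uniformGeomDefect_of_defectBoundedBy [RegularGaugeGroup G] (D : FiniteEpsData F G) (g₀ : ℕ → ℝ)
    (h : ∀ Cs : List (ULoop F), ∃ C r : ℝ, 0 ≤ C ∧ 0 ≤ r ∧ r < 1 ∧ ∀ K,
      DefectBoundedBy (D.av K) (D.real.Trho K (g₀ K)) (D.real.R K (g₀ K))
        (fun k => C * r ^ (K - 1 - k) * ∫ V, rho D K (g₀ K) K V ∂fieldMeasure (F.P K) K G) K (prodLoop K Cs)) :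
    UniformGeomDefect D g₀ := by
  intro Cs
  obtain ⟨C, r, hC, hr0, hr1, hK⟩ := h Cs
  refine ⟨C, r, hC, hr0, hr1, fun K n hn => ?_⟩
  have hZ := integral_rho_pos D K (g₀ K)
  have hb := (defectBoundedBy_iff_distDefect (D.av K) (D.real.Trho K (g₀ K)) (D.real.R K (g₀ K)) _ K
    (prodLoop K Cs)).1 (hK K) n hn
  have e : K - 1 - (K - 1 - n) = n := by omega
  rw [e] at hb
  rw [normDefect, abs_div, abs_of_pos hZ, div_le_iff₀ hZ]
  exact hb

/-- THE O3-alt COLLAPSE for the cell's data: if the realised R-steps of run `K` are weakly invisible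
(`T4Spectator.RWeaklyInvisible`, an UNPRINTED hypothesis the tree names), every normalised defect of that run
vanishes. [folklore] -/
theorem normDefect_eq_zero_of_invisible [RegularGaugeGroup G] (D : FiniteEpsData F G) (hM : D.AvgMeasurable)
    (g₀ : ℕ → ℝ) {K : ℕ} (hR : RWeaklyInvisible D K (g₀ K)) (Cs : List (ULoop F)) (n : ℕ) :
    normDefect D g₀ K Cs n = 0 := by
  rw [normDefect, distDefect_eq_zero_of_weaklyInvisible (D.av K) (D.real.Trho K (g₀ K)) (D.real.R K (g₀ K)) (hM K) K
    hR (prodLoop K Cs) (measurable_prodLoop K Cs) ⟨1, abs_prodLoop_le_one K Cs⟩ n, zero_div]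

/-! ## §4 The lane's existence theorem: three hypothesis shapes and what they give -/

/-- HYPOTHESIS SHAPE — FINAL-DENSITY MATCHING (UNDRESSED): per string of labels, the final-density expectations of the plain
loop product in consecutive runs have SUMMABLE differences.  Printed template (d = 3, abelian): King's Theorem 3.4 (3.9) —
after k resp. k+n steps the SMALL-FIELD PARTS `χ_k·(…)` of the two runs' effective actions `S^{(k),1}`, `S^{(k+n),1}` on the
common unit lattice T_1^{(k)} differ by at most `C(L^{−γk}(L^kε_K)^{−β} + (L^kε_K)^σ)|T|` — and its consequence (3.10)–(3.13)
«{Z^{ε_K}(T_{ε_K}, g, h)} is a Cauchy sequence» (King compares at an optimised intermediate k, (3.12); this shape compares at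
the end of both runs; v3 wording after cross-read C-pv12g12-5); for Bałaban's four-dimensional densities
NOTHING of the kind is printed (cell node U5 at source strength 0; GAPS G-ne1p3-4).  The two final densities live on the unit
lattices of two different tori of the family, so the statement is about the two REAL NUMBERS only.
[cite: King1986, Thm 3.4 (3.9)–(3.13) pp.656–657] -/
def FinalMatching (D : FiniteEpsData F G) (g₀ : ℕ → ℝ) : Prop :=
  ∀ Cs : List (ULoop F), ∃ b : ℕ → ℝ, Summable b ∧
    ∀ K, |finalExpect D g₀ (K + 1) Cs - finalExpect D g₀ K Cs| ≤ b K

/-- HYPOTHESIS SHAPE — THE LONGER RUN'S FIRST-STEP DEFECT IS SUMMABLE IN `K`: per string, `|normDefect (K+1) K| ≤ c K` with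
`Σ c < ∞` (the step farthest from the observable; implied by `UniformGeomDefect`). NOT PRINTED. [folklore] -/
def FirstDefectSummable (D : FiniteEpsData F G) (g₀ : ℕ → ℝ) : Prop :=
  ∀ Cs : List (ULoop F), ∃ c : ℕ → ℝ, Summable c ∧ ∀ K, |normDefect D g₀ (K + 1) Cs K| ≤ c K

/-- `UniformGeomDefect ⇒ FirstDefectSummable` (`c K = C·r^K`). [folklore] -/
theorem firstDefectSummable_of_uniformGeomDefect (D : FiniteEpsData F G) (g₀ : ℕ → ℝ) (h : UniformGeomDefect D g₀) :
    FirstDefectSummable D g₀ := by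
  intro Cs
  obtain ⟨C, r, _, hr0, hr1, hK⟩ := h Cs
  exact ⟨fun K => C * r ^ K, (summable_geometric_of_lt_one hr0 hr1).mul_left C,
    abs_first_le_of_uniform (u := fun K n => normDefect D g₀ K Cs n) hK⟩

/-- HYPOTHESIS SHAPE — DEFECT MATCHING, THE LANE'S TWO-RUN MISSING INEQUALITY: per string, the partner defects of the runs
`K+1` and `K` at equal scale distance `n < K` (the SAME spectator weight — the loop product pulled back `n` levels — tested
against one ℝ-step of each run) have differences whose sum over `n` is summable in `K`.  NOT PRINTED; no supplier in the
cell (GAPS G-ne1p3-3); the quantitative supplier shape is `DefectSensitivity`. [folklore] -/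
def DefectMatching (D : FiniteEpsData F G) (g₀ : ℕ → ℝ) : Prop :=
  ∀ Cs : List (ULoop F), ∃ w : ℕ → ℝ, Summable w ∧
    ∀ K, ∑ n ∈ Finset.range K, |normDefect D g₀ (K + 1) Cs n - normDefect D g₀ K Cs n| ≤ w K

/-- HYPOTHESIS SHAPE — DEFECT SENSITIVITY (the row text's «first-order sensitivity × the runs' accumulated disagreement»,
typed): per string there is `S ≥ 0` with
`|normDefect (K+1) n − normDefect K n| ≤ S · r^n · deltaAt E ρ inj K (K−n)` for all `n < K` — the weight's sensitivity decays
geometrically in the scale distance (`r`: the observable-side contraction, generation 1's `θ₁φ`-type factor against the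
count) and multiplies the cell's transported injected discrepancy accumulated at the level where the two partner steps act.
NOT PRINTED; a candidate currency, not a claim. [folklore] -/
def DefectSensitivity (D : FiniteEpsData F G) (g₀ : ℕ → ℝ) (E ρ r : ℝ) (inj : ℕ → ℕ → ℝ) : Prop :=
  ∀ Cs : List (ULoop F), ∃ S : ℝ, 0 ≤ S ∧
    ∀ K n, n < K → |normDefect D g₀ (K + 1) Cs n - normDefect D g₀ K Cs n| ≤ S * r ^ n * deltaAt E ρ inj K (K - n)

/-- `DefectSensitivity` with an injected rate of ratio `θ < 1`, contraction `ρ < 1` and observable-side ratio `r < 1`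
⇒ `DefectMatching` (§2: `sum_abs_sub_le_of_sensitivity`, `summable_sensitivityMajorant`). [folklore] -/
theorem defectMatching_of_sensitivity (D : FiniteEpsData F G) (g₀ : ℕ → ℝ) {C θ E ρ r : ℝ} {c : ℕ}
    {inj : ℕ → ℕ → ℝ} (hinj : T4CauchySum.InjectedRate C c θ inj) (hE : 0 ≤ E) (hθ : 0 ≤ θ) (hθ1 : θ < 1)
    (hρ : 0 ≤ ρ) (hρ1 : ρ < 1) (hr : 0 ≤ r) (hr1 : r < 1) (h : DefectSensitivity D g₀ E ρ r inj) :
    DefectMatching D g₀ := by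
  intro Cs
  obtain ⟨S, hS, hK⟩ := h Cs
  exact ⟨fun K => S * E * C * ((K : ℝ) + 1) ^ (c + 2) * (max r (max θ ρ)) ^ K,
    summable_sensitivityMajorant hθ1 hρ1 hr hr1,
    sum_abs_sub_le_of_sensitivity (u := fun K n => normDefect D g₀ K Cs n) hinj hS hE hθ hρ hr hK⟩

/-- **THE LANE'S EXISTENCE THEOREM**: final-density matching + summable first-step defect + defect matching ⇒ the continuum
limit of ALL joint expectations of the cell's observable class exists (`Missing.HasContinuumLimit (D.scheme g₀)`), via the
decomposition `expectAt_eq_finalExpect_add_sum`, the two-run arithmetic of §2 and the observable-level spine top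
`T4VarianceMatching.hasContinuumLimit_of_summable_increments` (used by name).  CONDITIONAL on the three shapes, none of which
is printed or proved for Bałaban's densities. [folklore] -/
theorem hasContinuumLimit_of_twoRun [RegularGaugeGroup G] (D : FiniteEpsData F G) (hM : D.AvgMeasurable)
    (g₀ : ℕ → ℝ) (hA : FinalMatching D g₀) (hc : FirstDefectSummable D g₀) (hw : DefectMatching D g₀) :
    HasContinuumLimit (D.scheme g₀) :=
  T4VarianceMatching.hasContinuumLimit_of_summable_increments (D.scheme g₀) fun Cs => by
    obtain ⟨b, hb, hbK⟩ := hA Cs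
    obtain ⟨c, hc', hcK⟩ := hc Cs
    obtain ⟨w, hw', hwK⟩ := hw Cs
    exact summable_increments_of_twoRun (E := fun K => (D.scheme g₀).expectAt K Cs)
      (A := fun K => finalExpect D g₀ K Cs) (u := fun K n => normDefect D g₀ K Cs n)
      (fun K => expectAt_eq_finalExpect_add_sum D hM g₀ K Cs) hb hc' hw' hbK hcK hwK

/-- The same from the K-uniform NE1′-telescoping output in place of the first-step shape. [folklore] -/
theorem hasContinuumLimit_of_twoRun' [RegularGaugeGroup G] (D : FiniteEpsData F G) (hM : D.AvgMeasurable)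
    (g₀ : ℕ → ℝ) (hA : FinalMatching D g₀) (hU : UniformGeomDefect D g₀) (hw : DefectMatching D g₀) :
    HasContinuumLimit (D.scheme g₀) :=
  hasContinuumLimit_of_twoRun D hM g₀ hA (firstDefectSummable_of_uniformGeomDefect D g₀ hU) hw

/-- THE THREE SHAPES ALONG THE LANE, bundled as the conclusion asked of a tuned bare-coupling sequence. [folklore] -/
def TwoRunTelescopeData (D : FiniteEpsData F G) (g₀ : ℕ → ℝ) : Prop :=
  FinalMatching D g₀ ∧ FirstDefectSummable D g₀ ∧ DefectMatching D g₀

/-- Under weak invisibility of every run's realised R-steps the two defect shapes hold with zero majorants, so along this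
lane existence then rests on `FinalMatching` ALONE (the two-run form of the O3-alt collapse; consistency check). [folklore] -/
theorem twoRunTelescopeData_of_invisible [RegularGaugeGroup G] (D : FiniteEpsData F G) (hM : D.AvgMeasurable)
    (g₀ : ℕ → ℝ) (hR : ∀ K, RWeaklyInvisible D K (g₀ K)) (hA : FinalMatching D g₀) : TwoRunTelescopeData D g₀ :=
  ⟨hA, fun Cs => ⟨0, summable_zero, fun K => by simp [normDefect_eq_zero_of_invisible D hM g₀ (hR _) Cs]⟩,
    fun Cs => ⟨0, summable_zero, fun K => by simp [normDefect_eq_zero_of_invisible D hM g₀ (hR _) Cs]⟩⟩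

/-- **TARGET `ym4_torus_continuum_limit_exists` ⇐ the three shapes under the cell's prefix** (β-side hypothesis `BetaPertHyp`
and the printed end statement (B) are the explicit antecedents of `UnderHypotheses`; `AvgMeasurable` named).  So what is open
in the target ALONG THIS LANE is exactly: the three shapes for every tuned bare-coupling sequence. [folklore] -/
theorem ym4_torus_continuum_limit_exists_of_twoRun [RegularGaugeGroup G] (D : FiniteEpsData F G) (hM : D.AvgMeasurable)
    (h : D.UnderHypotheses (BetaPertHyp D.βfun) fun g₀ => TwoRunTelescopeData D g₀) :
    D.ym4_torus_continuum_limit_exists :=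
  FiniteEpsData.UnderHypotheses.mono
    (fun g₀ hg => (hasContinuumLimit_iff_exists_isLimitFunctional (D.scheme g₀)).mp
      (hasContinuumLimit_of_twoRun D hM g₀ hg.1 hg.2.1 hg.2.2)) h

/-- **TARGET `ym4_torus_continuum_limit_unique` ⇐ the same** (existence ⇒ uniqueness, tree
`limit_unique_of_limit_exists`). [cite: MagnenRivasseauSeneor1993, p.326] -/
theorem ym4_torus_continuum_limit_unique_of_twoRun [RegularGaugeGroup G] (D : FiniteEpsData F G) (hM : D.AvgMeasurable)
    (h : D.UnderHypotheses (BetaPertHyp D.βfun) fun g₀ => TwoRunTelescopeData D g₀) :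
    D.ym4_torus_continuum_limit_unique :=
  D.limit_unique_of_limit_exists (ym4_torus_continuum_limit_exists_of_twoRun D hM h)

/-- PRINT-FAITHFUL FORM (β-side hypothesis = the endpoint-existence half of [Balaban1987RG1] Thm 2 p. 259,
`DagBinding.EndpointExistence D.C.toB12`, as in the tree's primed targets). [cite: Balaban1987RG1, Thm 2 p.259] -/
theorem ym4_torus_continuum_limit_exists'_of_twoRun [RegularGaugeGroup G] (D : FiniteEpsData F G) (hM : D.AvgMeasurable)
    (h : D.UnderHypotheses (DagBinding.EndpointExistence D.C.toB12) fun g₀ => TwoRunTelescopeData D g₀) :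
    D.ym4_torus_continuum_limit_exists' :=
  FiniteEpsData.UnderHypotheses.mono
    (fun g₀ hg => (hasContinuumLimit_iff_exists_isLimitFunctional (D.scheme g₀)).mp
      (hasContinuumLimit_of_twoRun D hM g₀ hg.1 hg.2.1 hg.2.2)) h

/-- PRINT-FAITHFUL FORM of the uniqueness target. [cite: Balaban1987RG1, Thm 2 p.259] -/
theorem ym4_torus_continuum_limit_unique'_of_twoRun [RegularGaugeGroup G] (D : FiniteEpsData F G) (hM : D.AvgMeasurable)
    (h : D.UnderHypotheses (DagBinding.EndpointExistence D.C.toB12) fun g₀ => TwoRunTelescopeData D g₀) :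
    D.ym4_torus_continuum_limit_unique' :=
  D.limit_unique'_of_limit_exists' (ym4_torus_continuum_limit_exists'_of_twoRun D hM h)

end Cell

/-! ## §5 (v2) The comparison level is free: mid-level expectations, near/far defects, and existence from one-run sizes +
mid-level matching (King's «we are free to choose k as we like», (3.12), transplanted to the observable) -/

section MidLevel

variable {P : Params} {G : Type*} [GaugeGroup G] [MeasurableSpace G] [HaarData G]

/-- THE MID-LEVEL NUMERATOR `∫dV ρ_{K−m}(V) f^{(m)}(V)`: the weight `f` pulled back `m` levels (through `avg_{K−1}, …, avg_{K−m}`)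
integrated against the density of the SAME chain at level `K − m` — by recursion on `K`, saturating at level `0`
(`midIntegral 0 f m = ∫ρ₀ f`, `midIntegral (K+1) f 0 = ∫ρ_{K+1} f`, `midIntegral (K+1) f (m+1) = midIntegral K (f ∘ avg_K) m`).
`m = 0` is the final-density numerator, `m = K` the initial one (`midIntegral_self`). [folklore] -/
def midIntegral (av : ∀ j, Averaging P j G) (ρ : (k : ℕ) → Density P k G) :
    (K : ℕ) → (GaugeField P K G → ℝ) → ℕ → ℝ
  | 0, f, _ => ∫ V, ρ 0 V * f V ∂fieldMeasure P 0 G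
  | K + 1, f, 0 => ∫ V, ρ (K + 1) V * f V ∂fieldMeasure P (K + 1) G
  | K + 1, f, m + 1 => midIntegral av ρ K (fun U => f ((av K).avg U)) m

variable (av : ∀ j, Averaging P j G) (ρ : (k : ℕ) → Density P k G) (Tρ : (k : ℕ) → Density P (k + 1) G)
  (R : (k : ℕ) → Density P (k + 1) G → Density P (k + 1) G)

/-- Distance `0`: the final-density numerator. [folklore] -/
theorem midIntegral_zero_right : ∀ (K : ℕ) (f : GaugeField P K G → ℝ),
    midIntegral av ρ K f 0 = ∫ V, ρ K V * f V ∂fieldMeasure P K G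
  | 0, _ => rfl
  | _ + 1, _ => rfl

/-- The recursion step. [folklore] -/
theorem midIntegral_succ_succ (K : ℕ) (f : GaugeField P (K + 1) G → ℝ) (m : ℕ) :
    midIntegral av ρ (K + 1) f (m + 1) = midIntegral av ρ K (fun U => f ((av K).avg U)) m := rfl

/-- Distance `K`: the initial-density numerator of the fully pulled-back weight, `∫dU ρ₀(U) f(Ū^K)` — so comparing two runs
«at distance `K`» compares their expectations themselves (the costume end of the schedule; see `MidMatching`). [folklore] -/
theorem midIntegral_self : ∀ (K : ℕ) (f : GaugeField P K G → ℝ),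
    midIntegral av ρ K f K = ∫ U, ρ 0 U * f (Averaging.iter av K U) ∂fieldMeasure P 0 G
  | 0, _ => rfl
  | K + 1, f => by
    rw [midIntegral_succ_succ, midIntegral_self K]
    rfl

/-- **THE PARTIAL TELESCOPING IDENTITY**: along a printed chain with measurable averagings, for every bounded measurable
weight and EVERY comparison distance `m`,
`∫dU ρ₀(U) f(Ū^K) = ∫dV ρ_{K−m} f^{(m)} + Σ_{m ≤ n < K} distDefect K f n` — only the FAR defects (the steps before level
`K − m`) separate the expectation from the mid-level evaluation of the pulled-back weight; T-steps are exact push-forwards.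
Generation 1's identity is `m = 0`. [folklore] -/
theorem integral_zero_mul_comp_iter_eq_mid (hav : ∀ j, Measurable (av j).avg) :
    ∀ (K : ℕ), PrintedChain av ρ Tρ R K → ∀ (f : GaugeField P K G → ℝ), Measurable f → (∃ C : ℝ, ∀ V, |f V| ≤ C) →
      ∀ m : ℕ, ∫ U, ρ 0 U * f (Averaging.iter av K U) ∂fieldMeasure P 0 G
        = midIntegral av ρ K f m + ∑ n ∈ Finset.Ico m K, distDefect av Tρ R K f n
  | 0, _, f, _, _, m => by
    rw [Finset.Ico_eq_empty_of_le (Nat.zero_le m), Finset.sum_empty, add_zero]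
    rfl
  | K + 1, hch, f, hf, hfb, 0 => by
    rw [integral_zero_mul_comp_iter_eq av hav ρ Tρ R (K + 1) hch f hf hfb, telescopeSum_eq_sum_distDefect,
      Finset.range_eq_Ico]
    rfl
  | K + 1, hch, f, hf, hfb, m + 1 => by
    obtain ⟨C, hC⟩ := hfb
    have ih := integral_zero_mul_comp_iter_eq_mid hav K (hch.mono (Nat.le_succ K)) (fun U => f ((av K).avg U))
      (hf.comp (hav K)) ⟨C, fun U => hC _⟩ m
    calc ∫ U, ρ 0 U * f (Averaging.iter av (K + 1) U) ∂fieldMeasure P 0 G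
        = ∫ U, ρ 0 U * f ((av K).avg (Averaging.iter av K U)) ∂fieldMeasure P 0 G := rfl
      _ = midIntegral av ρ K (fun U => f ((av K).avg U)) m
            + ∑ n ∈ Finset.Ico m K, distDefect av Tρ R K (fun U => f ((av K).avg U)) n := ih
      _ = midIntegral av ρ (K + 1) f (m + 1) + ∑ n ∈ Finset.Ico m K, distDefect av Tρ R (K + 1) f (n + 1) := rfl
      _ = midIntegral av ρ (K + 1) f (m + 1) + ∑ n ∈ Finset.Ico (m + 1) (K + 1), distDefect av Tρ R (K + 1) f n := by
          rw [Finset.sum_Ico_add']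

/-- **NEAR DEFECTS**: for `m ≤ K`, `∫ρ_{K−m} f^{(m)} = ∫ρ_K f + Σ_{n<m} distDefect K f n` — the mid-level evaluation differs
from the final one exactly by the defects of the LAST `m` steps. [folklore] -/
theorem midIntegral_eq_integral_add_sum (hav : ∀ j, Measurable (av j).avg) {K : ℕ} (hch : PrintedChain av ρ Tρ R K)
    (f : GaugeField P K G → ℝ) (hf : Measurable f) (hfb : ∃ C : ℝ, ∀ V, |f V| ≤ C) {m : ℕ} (hm : m ≤ K) :
    midIntegral av ρ K f m
      = ∫ V, ρ K V * f V ∂fieldMeasure P K G + ∑ n ∈ Finset.range m, distDefect av Tρ R K f n := by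
  have h1 := integral_zero_mul_comp_iter_eq_mid av ρ Tρ R hav K hch f hf hfb m
  have h0 := integral_zero_mul_comp_iter_eq_mid av ρ Tρ R hav K hch f hf hfb 0
  rw [midIntegral_zero_right, ← Finset.range_eq_Ico] at h0
  rw [h0, ← Finset.sum_range_add_sum_Ico _ hm] at h1
  linarith

/-- FAR DEFECTS UNDER GEOMETRIC SIZES: `|Σ_{m ≤ n < K'} u n| ≤ C·r^m/(1−r)` whenever `|u n| ≤ C·r^n` for `n < K'`. [folklore] -/
theorem abs_sum_Ico_le_of_geom {u : ℕ → ℝ} {C r : ℝ} (hC : 0 ≤ C) (hr0 : 0 ≤ r) (hr1 : r < 1) {K' : ℕ} (m : ℕ)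
    (h : ∀ n, n < K' → |u n| ≤ C * r ^ n) : |∑ n ∈ Finset.Ico m K', u n| ≤ C * r ^ m / (1 - r) := by
  calc |∑ n ∈ Finset.Ico m K', u n| ≤ ∑ n ∈ Finset.Ico m K', |u n| := Finset.abs_sum_le_sum_abs _ _
    _ ≤ ∑ n ∈ Finset.Ico m K', C * r ^ n :=
        Finset.sum_le_sum fun n hn => h n (Finset.mem_Ico.1 hn).2
    _ = ∑ k ∈ Finset.range (K' - m), C * r ^ m * r ^ k := by
        rw [Finset.sum_Ico_eq_sum_range]
        refine Finset.sum_congr rfl fun k _ => ?_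
        rw [pow_add, mul_assoc]
    _ ≤ C * r ^ m / (1 - r) := sum_range_mul_pow_le (mul_nonneg hC (pow_nonneg hr0 m)) hr0 hr1 _

/-- The increment between two runs decomposed at a common comparison distance: mid-level mismatch + two far tails. [folklore] -/
theorem abs_increment_le_mid {M M' S S' b c c' : ℝ} (hM : |M' - M| ≤ b) (hS' : |S'| ≤ c') (hS : |S| ≤ c) :
    |M' + S' - (M + S)| ≤ b + (c' + c) := by
  have e : M' + S' - (M + S) = M' - M + S' - S := by ring
  rw [e]
  have h1 := abs_sub (M' - M + S') S
  have h2 := abs_add_le (M' - M) S'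
  linarith

end MidLevel

section CellMid

open T4Continuum Missing

variable {F : T4Family} {G : Type*} [GaugeGroup G] [MeasurableSpace G] [HaarData G]

/-- RUN `K`'S MID-LEVEL EXPECTATION AT DISTANCE `m`: the loop product pulled back `m` levels, integrated against the run's
density at level `K − m`, divided by `∫ρ_K^{(K)}` (= `∫ρ_{K−m}^{(K)}` by (0.4), not used).  `m = 0`: `finalExpect`
(`midExpect_zero`); `m = K`: the expectation itself (`midExpect_self`). [folklore] -/
def midExpect (D : FiniteEpsData F G) (g₀ : ℕ → ℝ) (K : ℕ) (Cs : List (ULoop F)) (m : ℕ) : ℝ :=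
  midIntegral (D.av K) (rho D K (g₀ K)) K (prodLoop K Cs) m / ∫ V, rho D K (g₀ K) K V ∂fieldMeasure (F.P K) K G

/-- Distance `0` is the final-density expectation. [folklore] -/
theorem midExpect_zero (D : FiniteEpsData F G) (g₀ : ℕ → ℝ) (K : ℕ) (Cs : List (ULoop F)) :
    midExpect D g₀ K Cs 0 = finalExpect D g₀ K Cs := by
  rw [midExpect, midIntegral_zero_right]
  rfl

/-- NEAR DEFECTS for the cell's data: `midExpect K m = finalExpect K + Σ_{n<m} normDefect K n` (`m ≤ K`). [folklore] -/
theorem midExpect_eq_finalExpect_add_sum [RegularGaugeGroup G] (D : FiniteEpsData F G) (hM : D.AvgMeasurable)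
    (g₀ : ℕ → ℝ) (Cs : List (ULoop F)) {K m : ℕ} (hm : m ≤ K) :
    midExpect D g₀ K Cs m = finalExpect D g₀ K Cs + ∑ n ∈ Finset.range m, normDefect D g₀ K Cs n := by
  rw [midExpect, midIntegral_eq_integral_add_sum (D.av K) (rho D K (g₀ K)) (D.real.Trho K (g₀ K)) (D.real.R K (g₀ K))
    (hM K) (printedChain_rho D K (g₀ K)) (prodLoop K Cs) (measurable_prodLoop K Cs) ⟨1, abs_prodLoop_le_one K Cs⟩ hm,
    add_div, Finset.sum_div]
  rfl

/-- **THE DECOMPOSITION AT A FREE COMPARISON DISTANCE** (unconditional given `D.AvgMeasurable`): for `m ≤ K`,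
`(D.scheme g₀).expectAt K Cs = midExpect D g₀ K Cs m + Σ_{m ≤ n < K} normDefect D g₀ K Cs n`. [folklore] -/
theorem expectAt_eq_midExpect_add_sum [RegularGaugeGroup G] (D : FiniteEpsData F G) (hM : D.AvgMeasurable)
    (g₀ : ℕ → ℝ) (Cs : List (ULoop F)) {K m : ℕ} (hm : m ≤ K) :
    (D.scheme g₀).expectAt K Cs = midExpect D g₀ K Cs m + ∑ n ∈ Finset.Ico m K, normDefect D g₀ K Cs n := by
  rw [expectAt_eq_finalExpect_add_sum D hM g₀ K Cs, midExpect_eq_finalExpect_add_sum D hM g₀ Cs hm, add_assoc,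
    Finset.sum_range_add_sum_Ico _ hm]

/-- THE COSTUME END: at distance `K` the mid-level expectation IS the expectation (so a «matching at distance `K`» would be
the Cauchy property itself, not a supplier of it). [folklore] -/
theorem midExpect_self [RegularGaugeGroup G] (D : FiniteEpsData F G) (hM : D.AvgMeasurable) (g₀ : ℕ → ℝ) (K : ℕ)
    (Cs : List (ULoop F)) : midExpect D g₀ K Cs K = (D.scheme g₀).expectAt K Cs := by
  rw [expectAt_eq_midExpect_add_sum D hM g₀ Cs le_rfl, Finset.Ico_self, Finset.sum_empty, add_zero]

/-- HYPOTHESIS SHAPE — MID-LEVEL MATCHING ALONG A SCHEDULE BEATING THE OBSERVABLE'S DECAY RATIO: per string and per ratio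
`r ∈ [0,1[` there are a comparison schedule `m : ℕ → ℕ` with `m K ≤ K` and `Σ_K r^{m K} < ∞` and a summable `b` with
`|midExpect (K+1) (m K) − midExpect K (m K)| ≤ b K` — the two runs' densities AT EQUAL DISTANCE `m K` FROM THEIR ENDS (the
same lattice size; King's `S^{(k),1}` vs `S^{(k+1),1}` on `T_1^{(k)}`), tested against the pulled-back loop product, agree
summably.  HONEST RANGE: `m ≡ 0` is excluded (`Σ r^0 = ∞`; that end is §4 with `DefectMatching`); `m K = K` makes the shape
the Cauchy property itself (`midExpect_self`) — a costume; the content lies in between, where a supplier trades the far tail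
`r^{m(K)}` against the volume `L^{4m(K)}` carrying the two mid-level densities (e.g. `m(K) ≍ log K`; record §6, [analysis]).
NOT PRINTED for Bałaban's densities (cell node U5, undressed, at an intermediate level; GAPS G-ne1p3-4); never asserted.
[cite: King1986, (3.12)–(3.13) p.657] -/
def MidMatching (D : FiniteEpsData F G) (g₀ : ℕ → ℝ) : Prop :=
  ∀ (Cs : List (ULoop F)) (r : ℝ), 0 ≤ r → r < 1 → ∃ (m : ℕ → ℕ) (b : ℕ → ℝ), (∀ K, m K ≤ K) ∧
    Summable (fun K => r ^ m K) ∧ Summable b ∧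
      ∀ K, |midExpect D g₀ (K + 1) Cs (m K) - midExpect D g₀ K Cs (m K)| ≤ b K

/-- **EXISTENCE FROM ONE-RUN SIZES AND MID-LEVEL MATCHING** — no two-run comparison of defects: the K-uniform
NE1′-telescoping output `UniformGeomDefect` (`|normDefect K n| ≤ C·r^n` for all `n < K`, one run at a time; only the
far tails `n ≥ m K` are used) and
`MidMatching` give summable increments — `|⟨∏⟩_{K+1} − ⟨∏⟩_K| ≤ b K + 2·C·r^{m K}/(1−r)` by `expectAt_eq_midExpect_add_sum`
in both runs at the common distance `m K` and `abs_sum_Ico_le_of_geom` for the two far tails — hence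
`Missing.HasContinuumLimit (D.scheme g₀)` by `T4VarianceMatching.hasContinuumLimit_of_summable_increments`.  CONDITIONAL on
the two shapes, neither printed nor proved for Bałaban's densities. [folklore] -/
theorem hasContinuumLimit_of_midMatching [RegularGaugeGroup G] (D : FiniteEpsData F G) (hM : D.AvgMeasurable)
    (g₀ : ℕ → ℝ) (hU : UniformGeomDefect D g₀) (hA : MidMatching D g₀) : HasContinuumLimit (D.scheme g₀) :=
  T4VarianceMatching.hasContinuumLimit_of_summable_increments (D.scheme g₀) fun Cs => by
    obtain ⟨C, r, hC, hr0, hr1, hK⟩ := hU Cs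
    obtain ⟨m, b, hmK, hrm, hb, hbK⟩ := hA Cs r hr0 hr1
    refine ⟨fun K => b K + (C * r ^ m K / (1 - r) + C * r ^ m K / (1 - r)),
      hb.add (((hrm.mul_left C).div_const (1 - r)).add ((hrm.mul_left C).div_const (1 - r))), fun K => ?_⟩
    rw [expectAt_eq_midExpect_add_sum D hM g₀ Cs ((hmK K).trans (Nat.le_succ K)),
      expectAt_eq_midExpect_add_sum D hM g₀ Cs (hmK K)]
    exact abs_increment_le_mid (hbK K) (abs_sum_Ico_le_of_geom hC hr0 hr1 (m K) (hK (K + 1)))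
      (abs_sum_Ico_le_of_geom hC hr0 hr1 (m K) (hK K))

/-- THE TWO SHAPES OF THE FREE-LEVEL ROUTE, bundled. [folklore] -/
def MidLevelTelescopeData (D : FiniteEpsData F G) (g₀ : ℕ → ℝ) : Prop :=
  UniformGeomDefect D g₀ ∧ MidMatching D g₀

/-- **TARGET `ym4_torus_continuum_limit_exists` ⇐ one-run geometric defects + mid-level matching, under the cell's prefix**
(β-hypothesis `BetaPertHyp` and (B) explicit in `UnderHypotheses`). [folklore] -/
theorem ym4_torus_continuum_limit_exists_of_midMatching [RegularGaugeGroup G] (D : FiniteEpsData F G)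
    (hM : D.AvgMeasurable) (h : D.UnderHypotheses (BetaPertHyp D.βfun) fun g₀ => MidLevelTelescopeData D g₀) :
    D.ym4_torus_continuum_limit_exists :=
  FiniteEpsData.UnderHypotheses.mono
    (fun g₀ hg => (hasContinuumLimit_iff_exists_isLimitFunctional (D.scheme g₀)).mp
      (hasContinuumLimit_of_midMatching D hM g₀ hg.1 hg.2)) h

/-- … and the uniqueness target. [cite: MagnenRivasseauSeneor1993, p.326] -/
theorem ym4_torus_continuum_limit_unique_of_midMatching [RegularGaugeGroup G] (D : FiniteEpsData F G)
    (hM : D.AvgMeasurable) (h : D.UnderHypotheses (BetaPertHyp D.βfun) fun g₀ => MidLevelTelescopeData D g₀) :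
    D.ym4_torus_continuum_limit_unique :=
  D.limit_unique_of_limit_exists (ym4_torus_continuum_limit_exists_of_midMatching D hM h)

/-- PRINT-FAITHFUL FORM of the free-level existence target. [cite: Balaban1987RG1, Thm 2 p.259] -/
theorem ym4_torus_continuum_limit_exists'_of_midMatching [RegularGaugeGroup G] (D : FiniteEpsData F G)
    (hM : D.AvgMeasurable)
    (h : D.UnderHypotheses (DagBinding.EndpointExistence D.C.toB12) fun g₀ => MidLevelTelescopeData D g₀) :
    D.ym4_torus_continuum_limit_exists' :=
  FiniteEpsData.UnderHypotheses.mono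
    (fun g₀ hg => (hasContinuumLimit_iff_exists_isLimitFunctional (D.scheme g₀)).mp
      (hasContinuumLimit_of_midMatching D hM g₀ hg.1 hg.2)) h

/-- PRINT-FAITHFUL FORM of the free-level uniqueness target. [cite: Balaban1987RG1, Thm 2 p.259] -/
theorem ym4_torus_continuum_limit_unique'_of_midMatching [RegularGaugeGroup G] (D : FiniteEpsData F G)
    (hM : D.AvgMeasurable)
    (h : D.UnderHypotheses (DagBinding.EndpointExistence D.C.toB12) fun g₀ => MidLevelTelescopeData D g₀) :
    D.ym4_torus_continuum_limit_unique' :=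
  D.limit_unique'_of_limit_exists' (ym4_torus_continuum_limit_exists'_of_midMatching D hM h)

end CellMid

/-! ## §6 (v3) The supplier side of `MidMatching`: the pulled-back weight at a fixed level, the schedule lemma in the kernel,
and the density-level venue at distance `m` from both ends -/

section Pullback

variable {P : Params} {G : Type*} [GaugeGroup G]

/-- THE WEIGHT PULLED BACK `m` LEVELS TO A FIXED LEVEL `k`: `pullback av k m f = f ∘ avg_{k+m−1} ∘ ⋯ ∘ avg_k` for a weight `f`
on `T^{(k+m)}` — cast-free recursion on `m` (the outermost averaging is peeled first, as in `midIntegral`). [folklore] -/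
def pullback (av : ∀ j, Averaging P j G) (k : ℕ) : (m : ℕ) → (GaugeField P (k + m) G → ℝ) → (GaugeField P k G → ℝ)
  | 0, f => f
  | m + 1, f => pullback av k m (fun U => f ((av (k + m)).avg U))

variable (av : ∀ j, Averaging P j G)

/-- [folklore] -/
theorem pullback_zero (k : ℕ) (f : GaugeField P k G → ℝ) : pullback av k 0 f = f := rfl

/-- [folklore] -/
theorem pullback_succ (k m : ℕ) (f : GaugeField P (k + m + 1) G → ℝ) :
    pullback av k (m + 1) f = pullback av k m (fun U => f ((av (k + m)).avg U)) := rfl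

/-- A uniform bound is inherited. [folklore] -/
theorem abs_pullback_le (k : ℕ) {C : ℝ} :
    ∀ (m : ℕ) (f : GaugeField P (k + m) G → ℝ), (∀ V, |f V| ≤ C) → ∀ U, |pullback av k m f U| ≤ C
  | 0, _, hf, U => hf U
  | m + 1, _, hf, U => abs_pullback_le k m _ (fun _ => hf _) U

variable [MeasurableSpace G]

/-- Measurability is inherited along measurable averagings. [folklore] -/
theorem measurable_pullback (hav : ∀ j, Measurable (av j).avg) (k : ℕ) :
    ∀ (m : ℕ) (f : GaugeField P (k + m) G → ℝ), Measurable f → Measurable (pullback av k m f)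
  | 0, _, hf => hf
  | m + 1, _, hf => measurable_pullback hav k m _ (hf.comp (hav (k + m)))

variable [HaarData G] (ρ : (k : ℕ) → Density P k G)

/-- **THE MID-LEVEL NUMERATOR AT DISTANCE `m` FROM THE END OF A RUN OF LENGTH `k + m` IS A LEVEL-`k` INTEGRAL**:
`midIntegral av ρ (k+m) f m = ∫dV ρ_k(V)·(pullback av k m f)(V)`. [folklore] -/
theorem midIntegral_add_eq :
    ∀ (m k : ℕ) (f : GaugeField P (k + m) G → ℝ),
      midIntegral av ρ (k + m) f m = ∫ V, ρ k V * pullback av k m f V ∂fieldMeasure P k G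
  | 0, k, f => midIntegral_zero_right av ρ k f
  | m + 1, k, f => midIntegral_add_eq m k (fun U => f ((av (k + m)).avg U))

end Pullback

/-! ### §6.1 The schedule lemma: `m(K) ≍ log K` beats every observable-side ratio `r < 1` and every volume factor `Λ ≥ 1`
against a far-tail ratio `q < 1` (King's (3.12) «we are free to choose k as we like», in the kernel) -/

section Schedule

/-- `2 ^ ⌊log₂(K+2)⌋ ≤ K + 2`. [folklore] -/
theorem two_pow_log_le (K : ℕ) : (2 : ℝ) ^ Nat.log 2 (K + 2) ≤ (K : ℝ) + 2 := by
  have h := Nat.pow_log_le_self 2 (show K + 2 ≠ 0 by omega)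
  exact_mod_cast h

/-- `K + 2 < 2 ^ (⌊log₂(K+2)⌋ + 1)`. [folklore] -/
theorem lt_two_pow_log_succ (K : ℕ) : (K : ℝ) + 2 < (2 : ℝ) ^ (Nat.log 2 (K + 2) + 1) := by
  have h := Nat.lt_pow_succ_log_self Nat.one_lt_two (K + 2)
  exact_mod_cast h

/-- `(1/2) ^ ⌊log₂(K+2)⌋ ≤ 2/(K+2)`. [folklore] -/
theorem half_pow_log_le (K : ℕ) : (1 / 2 : ℝ) ^ Nat.log 2 (K + 2) ≤ 2 / ((K : ℝ) + 2) := by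
  have hpos : (0 : ℝ) < (K : ℝ) + 2 := by positivity
  rw [le_div_iff₀ hpos]
  calc (1 / 2 : ℝ) ^ Nat.log 2 (K + 2) * ((K : ℝ) + 2)
      ≤ (1 / 2 : ℝ) ^ Nat.log 2 (K + 2) * (2 : ℝ) ^ (Nat.log 2 (K + 2) + 1) :=
        mul_le_mul_of_nonneg_left (lt_two_pow_log_succ K).le (pow_nonneg (by norm_num) _)
    _ = 2 := by rw [pow_succ, ← mul_assoc, ← mul_pow]; norm_num

/-- `Σ_K 4/(K+2)² < ∞`. [folklore] -/
theorem summable_four_div_sq : Summable (fun K : ℕ => (4 : ℝ) / ((K : ℝ) + 2) ^ 2) := by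
  have h : Summable (fun n : ℕ => ((n : ℝ) ^ 2)⁻¹) := Real.summable_nat_pow_inv.mpr one_lt_two
  have h2 : Summable (fun n : ℕ => ((((n + 2 : ℕ) : ℝ)) ^ 2)⁻¹) := (summable_nat_add_iff 2).mpr h
  refine (h2.mul_left 4).congr fun K => ?_
  push_cast
  rw [div_eq_mul_inv]

/-- **THE SCHEDULE LEMMA.**  For every observable-side ratio `0 ≤ r < 1`, far-tail ratio `0 ≤ q < 1`, volume factor `Λ ≥ 1`
and polynomial degree `d` there is a comparison schedule `m K ≤ K` with BOTH `Σ_K r^{m K} < ∞` and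
`Σ_K (K+1)^d · Λ^{m K} · q^{K − m K} < ∞` — namely `m K = min K (t·⌊log₂(K+2)⌋)` with `t` so large that
`max(r,½)^t ≤ ¼`: then `r^{m K} ≤ max(r,½)^K + 4/(K+2)²`, while `Λ^{m K} ≤ (2^s·max(q,½))^{m K}` (`Λ ≤ 2^s·max(q,½)`) costs
only the polynomial `(K+2)^{st}` against `max(q,½)^K`.  Elementary (no real logarithm); this is record §6 (6e)'s
`m(K) ≍ log K` balance, in the kernel. [folklore] -/
theorem exists_schedule {r q Λ : ℝ} (hr0 : 0 ≤ r) (hr1 : r < 1) (hq0 : 0 ≤ q) (hq1 : q < 1) (hΛ : 1 ≤ Λ) (d : ℕ) :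
    ∃ m : ℕ → ℕ, (∀ K, m K ≤ K) ∧ Summable (fun K : ℕ => r ^ m K) ∧
      Summable (fun K : ℕ => ((K : ℝ) + 1) ^ d * (Λ ^ m K * q ^ (K - m K))) := by
  set r' : ℝ := max r (1 / 2) with hr'
  set q' : ℝ := max q (1 / 2) with hq'
  have hr'0 : 0 ≤ r' := hr0.trans (le_max_left _ _)
  have hr'1 : r' < 1 := max_lt hr1 (by norm_num)
  have hrr' : r ≤ r' := le_max_left _ _
  have hq'pos : 0 < q' := lt_of_lt_of_le (by norm_num) (le_max_right _ _)
  have hq'1 : q' < 1 := max_lt hq1 (by norm_num)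
  have hqq' : q ≤ q' := le_max_left _ _
  have hΛ0 : 0 ≤ Λ := zero_le_one.trans hΛ
  obtain ⟨t, ht⟩ := exists_pow_lt_of_lt_one (show (0 : ℝ) < (1 / 2) ^ 2 by norm_num) hr'1
  obtain ⟨s, hs⟩ := pow_unbounded_of_one_lt (Λ / q') (one_lt_two : (1 : ℝ) < 2)
  have hΛs : Λ ≤ (2 : ℝ) ^ s * q' := by
    have := (div_lt_iff₀ hq'pos).mp hs
    linarith
  refine ⟨fun K => min K (t * Nat.log 2 (K + 2)), fun K => min_le_left _ _, ?_, ?_⟩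
  · -- `r ^ m K ≤ r' ^ K + 4/(K+2)^2`
    refine Summable.of_nonneg_of_le (fun K => pow_nonneg hr0 _)
      (fun K => ?_) ((summable_geometric_of_lt_one hr'0 hr'1).add summable_four_div_sq)
    have hfar : r' ^ (t * Nat.log 2 (K + 2)) ≤ 4 / ((K : ℝ) + 2) ^ 2 := by
      calc r' ^ (t * Nat.log 2 (K + 2)) = (r' ^ t) ^ Nat.log 2 (K + 2) := pow_mul _ _ _
        _ ≤ ((1 / 2 : ℝ) ^ 2) ^ Nat.log 2 (K + 2) := pow_le_pow_left₀ (pow_nonneg hr'0 t) ht.le _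
        _ = ((1 / 2 : ℝ) ^ Nat.log 2 (K + 2)) ^ 2 := by rw [← pow_mul, ← pow_mul, mul_comm]
        _ ≤ (2 / ((K : ℝ) + 2)) ^ 2 := pow_le_pow_left₀ (pow_nonneg (by norm_num) _) (half_pow_log_le K) 2
        _ = 4 / ((K : ℝ) + 2) ^ 2 := by rw [div_pow]; norm_num
    calc r ^ min K (t * Nat.log 2 (K + 2)) ≤ r' ^ min K (t * Nat.log 2 (K + 2)) := pow_le_pow_left₀ hr0 hrr' _
      _ ≤ r' ^ K + 4 / ((K : ℝ) + 2) ^ 2 := by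
          rcases min_cases K (t * Nat.log 2 (K + 2)) with ⟨h, _⟩ | ⟨h, _⟩
          · rw [h]; exact le_add_of_nonneg_right (by positivity)
          · rw [h]; exact (hfar.trans (le_add_of_nonneg_left (pow_nonneg hr'0 K)))
  · -- `(K+1)^d Λ^{m K} q^{K - m K} ≤ 2^{st} (K+1)^{d+st} q'^K`
    have hmaj := (T4CauchySum.summable_succ_pow_mul_geometric hq'pos.le hq'1 (d + s * t)).mul_left ((2 : ℝ) ^ (s * t))
    refine Summable.of_nonneg_of_le (fun K => mul_nonneg (pow_nonneg (by positivity) _)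
      (mul_nonneg (pow_nonneg hΛ0 _) (pow_nonneg hq0 _))) (fun K => ?_) hmaj
    set N := Nat.log 2 (K + 2) with hN
    set m := min K (t * N) with hm
    have hmK : m ≤ K := min_le_left _ _
    have hmt : m ≤ t * N := min_le_right _ _
    have hpos : (0 : ℝ) < (K : ℝ) + 2 := by positivity
    have h2s : (1 : ℝ) ≤ 2 ^ s := one_le_pow₀ (by norm_num)
    have hvol : Λ ^ m * q ^ (K - m) ≤ ((2 : ℝ) ^ s) ^ (t * N) * q' ^ K := by
      calc Λ ^ m * q ^ (K - m) ≤ ((2 : ℝ) ^ s * q') ^ m * q' ^ (K - m) :=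
            mul_le_mul (pow_le_pow_left₀ hΛ0 hΛs m) (pow_le_pow_left₀ hq0 hqq' _) (pow_nonneg hq0 _)
              (pow_nonneg (mul_nonneg (by positivity) hq'pos.le) m)
        _ = ((2 : ℝ) ^ s) ^ m * q' ^ K := by
            rw [mul_pow, mul_assoc, ← pow_add, Nat.add_sub_cancel' hmK]
        _ ≤ ((2 : ℝ) ^ s) ^ (t * N) * q' ^ K :=
            mul_le_mul_of_nonneg_right (pow_le_pow_right₀ h2s hmt) (pow_nonneg hq'pos.le K)
    have hpoly : ((2 : ℝ) ^ s) ^ (t * N) ≤ (2 : ℝ) ^ (s * t) * ((K : ℝ) + 1) ^ (s * t) := by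
      calc ((2 : ℝ) ^ s) ^ (t * N) = ((2 : ℝ) ^ N) ^ (s * t) := by
            rw [← pow_mul, ← pow_mul, show s * (t * N) = N * (s * t) by ring]
        _ ≤ ((K : ℝ) + 2) ^ (s * t) := pow_le_pow_left₀ (by positivity) (two_pow_log_le K) _
        _ ≤ (2 * ((K : ℝ) + 1)) ^ (s * t) := pow_le_pow_left₀ hpos.le (by linarith) _
        _ = (2 : ℝ) ^ (s * t) * ((K : ℝ) + 1) ^ (s * t) := mul_pow _ _ _
    calc ((K : ℝ) + 1) ^ d * (Λ ^ m * q ^ (K - m))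
        ≤ ((K : ℝ) + 1) ^ d * ((2 : ℝ) ^ (s * t) * ((K : ℝ) + 1) ^ (s * t) * q' ^ K) :=
          mul_le_mul_of_nonneg_left (hvol.trans (mul_le_mul_of_nonneg_right hpoly (pow_nonneg hq'pos.le K)))
            (pow_nonneg (by positivity) d)
      _ = (2 : ℝ) ^ (s * t) * (((K : ℝ) + 1) ^ (d + s * t) * q' ^ K) := by rw [pow_add]; ring

end Schedule

/-! ### §6.2 The real-number supplier shape: mid-level discrepancy with explicit volume factor ⇒ `MidMatching` -/

section CellSupplier

open T4Continuum Missing T4CauchySum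

variable {F : T4Family} {G : Type*} [GaugeGroup G] [MeasurableSpace G] [HaarData G]

/-- THE MID-LEVEL EXPECTATION AT DISTANCE `m` FROM THE END OF RUN `k + m` IS A NORMALISED LEVEL-`k` EXPECTATION: the loop
product pulled back `m` levels, against the run's density `ρ_k^{(k+m)}` at level `k`, over `∫ρ_{k+m}^{(k+m)}`. [folklore] -/
theorem midExpect_add_eq (D : FiniteEpsData F G) (g₀ : ℕ → ℝ) (k m : ℕ) (Cs : List (ULoop F)) :
    midExpect D g₀ (k + m) Cs m
      = (∫ V, rho D (k + m) (g₀ (k + m)) k V * pullback (D.av (k + m)) k m (prodLoop (k + m) Cs) V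
            ∂fieldMeasure (F.P (k + m)) k G)
          / ∫ V, rho D (k + m) (g₀ (k + m)) (k + m) V ∂fieldMeasure (F.P (k + m)) (k + m) G := by
  rw [midExpect, midIntegral_add_eq]

/-- TOTAL INTEGRALS DO NOT DEPEND ON THE LEVEL: `∫ρ_k^{(K)} = ∫ρ_K^{(K)}` for `k ≤ K` ((0.4) at every R-step and the T-steps at
weight 1; tree `T4Continuum.FiniteEpsData.integral_dens_eq_zero`). [cite: Balaban1989LargeFieldI, (0.4) p.176] -/
theorem integral_rho_level_eq (D : FiniteEpsData F G) (K : ℕ) (g : ℝ) {k : ℕ} (hk : k ≤ K) :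
    ∫ V, rho D K g k V ∂fieldMeasure (F.P K) k G = ∫ V, rho D K g K V ∂fieldMeasure (F.P K) K G := by
  rw [rho_eq_dens, rho_eq_dens, D.integral_dens_eq_zero K g k hk, D.integral_dens_eq_zero K g K le_rfl]

/-- … hence `∫ρ_k^{(K)} > 0` at every level `k ≤ K` on a regular gauge group. [folklore] -/
theorem integral_rho_level_pos [RegularGaugeGroup G] (D : FiniteEpsData F G) (K : ℕ) (g : ℝ) {k : ℕ} (hk : k ≤ K) :
    0 < ∫ V, rho D K g k V ∂fieldMeasure (F.P K) k G := by
  rw [integral_rho_level_eq D K g hk]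
  exact integral_rho_pos D K g

/-- The same mid-level expectation with the LEVEL-`k` total in the denominator (a genuinely level-`k` quantity: numerator and
denominator are integrals against `ρ_k^{(k+m)} dV` on `T^{(k)}` of the `(k+m)`-th torus). [folklore] -/
theorem midExpect_add_eq' (D : FiniteEpsData F G) (g₀ : ℕ → ℝ) (k m : ℕ) (Cs : List (ULoop F)) :
    midExpect D g₀ (k + m) Cs m
      = (∫ V, rho D (k + m) (g₀ (k + m)) k V * pullback (D.av (k + m)) k m (prodLoop (k + m) Cs) V
            ∂fieldMeasure (F.P (k + m)) k G)
          / ∫ V, rho D (k + m) (g₀ (k + m)) k V ∂fieldMeasure (F.P (k + m)) k G := by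
  rw [midExpect_add_eq, integral_rho_level_eq D (k + m) (g₀ (k + m)) (Nat.le_add_right k m)]

/-- HYPOTHESIS SHAPE — MID-LEVEL DISCREPANCY WITH EXPLICIT VOLUME (the real-number summary a density-level supplier of
`MidMatching` would deliver; NOT PRINTED, never asserted): per string there is `V ≥ 0` with, for every run `K` and every
distance `m ≤ K`,
`|midExpect (K+1) m − midExpect K m| ≤ V · Λ^m · deltaAt E ρ inj K (K − m)` — the two runs' densities at distance `m` from
their ends live on the `L^{4m}`-fold larger lattice of spacing `L^{−m}` (volume factor `Λ^m`, `Λ = L⁴` for a volume-linear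
norm such as total variation summed over unit cubes) and differ there by the cell's transported injected discrepancy
ACCUMULATED AT LEVEL `K − m` (`deltaAt`, §2; `≤ E·C·(K+1)^{c+1}·max(θ,ρ)^{K−m}` under `InjectedRate`, `deltaAt_le`).  At `m = 0`
this contains final-density matching at rate `delta K` (`FinalMatching`, U5 undressed at the end); only `m = m(K) ≍ log K` is
consumed below.  The density-level datum behind it is §6.3. [folklore] -/
def MidDiscrepancyRate (D : FiniteEpsData F G) (g₀ : ℕ → ℝ) (Λ E ρ : ℝ) (inj : ℕ → ℕ → ℝ) : Prop :=
  ∀ Cs : List (ULoop F), ∃ V : ℝ, 0 ≤ V ∧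
    ∀ K m, m ≤ K → |midExpect D g₀ (K + 1) Cs m - midExpect D g₀ K Cs m| ≤ V * Λ ^ m * deltaAt E ρ inj K (K - m)

/-- **`MidDiscrepancyRate` ⇒ `MidMatching`** — THE (6e) BALANCE IN THE KERNEL: with an injected rate of ratio `θ < 1`, a
contraction `ρ < 1`, any volume factor `Λ ≥ 1` and any observable-side ratio `r < 1`, the schedule of `exists_schedule`
(`m(K) ≍ log K`) makes `V·Λ^{m K}·deltaAt … K (K − m K) ≤ V·E·C·(K+1)^{c+1}·Λ^{m K}·max(θ,ρ)^{K−m K}` summable in `K` while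
`Σ_K r^{m K} < ∞`. [folklore] -/
theorem midMatching_of_midDiscrepancyRate (D : FiniteEpsData F G) (g₀ : ℕ → ℝ) {C θ E ρ Λ : ℝ} {c : ℕ}
    {inj : ℕ → ℕ → ℝ} (hinj : InjectedRate C c θ inj) (hE : 0 ≤ E) (hθ : 0 ≤ θ) (hθ1 : θ < 1) (hρ : 0 ≤ ρ)
    (hρ1 : ρ < 1) (hΛ : 1 ≤ Λ) (h : MidDiscrepancyRate D g₀ Λ E ρ inj) : MidMatching D g₀ := by
  intro Cs r hr0 hr1
  obtain ⟨V, hV, hK⟩ := h Cs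
  have hq0 : 0 ≤ max θ ρ := hθ.trans (le_max_left _ _)
  have hq1 : max θ ρ < 1 := max_lt hθ1 hρ1
  have hΛ0 : 0 ≤ Λ := zero_le_one.trans hΛ
  obtain ⟨m, hmK, hrm, hsum⟩ := exists_schedule hr0 hr1 hq0 hq1 hΛ (c + 1)
  refine ⟨m, fun K => V * (E * C) * (((K : ℝ) + 1) ^ (c + 1) * (Λ ^ m K * (max θ ρ) ^ (K - m K))), hmK, hrm,
    hsum.mul_left (V * (E * C)), fun K => ?_⟩
  calc |midExpect D g₀ (K + 1) Cs (m K) - midExpect D g₀ K Cs (m K)| ≤ V * Λ ^ m K * deltaAt E ρ inj K (K - m K) :=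
        hK K (m K) (hmK K)
    _ ≤ V * Λ ^ m K * (E * C * ((K : ℝ) + 1) ^ (c + 1) * (max θ ρ) ^ (K - m K)) :=
        mul_le_mul_of_nonneg_left (deltaAt_le hinj hE hθ hρ (Nat.sub_le K (m K))) (mul_nonneg hV (pow_nonneg hΛ0 _))
    _ = V * (E * C) * (((K : ℝ) + 1) ^ (c + 1) * (Λ ^ m K * (max θ ρ) ^ (K - m K))) := by ring

/-- THE `m = 0` SLICE of `MidDiscrepancyRate` IS final-density matching at rate `delta K` (`FinalMatching`, with
`b K = V · delta E ρ inj K`, summable by `T4CauchySum.summable_delta`) — recorded to document the shape's honest range: a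
supplier asserting `MidDiscrepancyRate` at ALL `m ≤ K` asserts in particular U5-at-the-end, undressed. [folklore] -/
theorem finalMatching_of_midDiscrepancyRate (D : FiniteEpsData F G) (g₀ : ℕ → ℝ) {C θ E ρ Λ : ℝ} {c : ℕ}
    {inj : ℕ → ℕ → ℝ} (hinj : InjectedRate C c θ inj) (hE : 0 ≤ E) (hθ : 0 ≤ θ) (hθ1 : θ < 1) (hρ : 0 ≤ ρ)
    (hρ1 : ρ < 1) (h : MidDiscrepancyRate D g₀ Λ E ρ inj) : FinalMatching D g₀ := by
  intro Cs
  obtain ⟨V, _, hK⟩ := h Cs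
  refine ⟨fun K => V * delta E ρ inj K, (summable_delta hinj hE hθ hθ1 hρ hρ1).mul_left V, fun K => ?_⟩
  have h0 := hK K 0 (Nat.zero_le K)
  simpa [midExpect_zero, deltaAt_self, Nat.sub_zero] using h0

/-- **EXISTENCE FROM ONE-RUN SIZES AND A MID-LEVEL DISCREPANCY RATE**: `UniformGeomDefect` (NE1′-tel sizes, one run at a time)
and `MidDiscrepancyRate` (undressed two-run matching at a free level with explicit volume, under an injected rate)
⇒ `Missing.HasContinuumLimit (D.scheme g₀)` (`midMatching_of_midDiscrepancyRate` + `hasContinuumLimit_of_midMatching`).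
CONDITIONAL on the two shapes, neither printed nor proved for Bałaban's densities. [folklore] -/
theorem hasContinuumLimit_of_midDiscrepancyRate [RegularGaugeGroup G] (D : FiniteEpsData F G) (hM : D.AvgMeasurable)
    (g₀ : ℕ → ℝ) (hU : UniformGeomDefect D g₀) {C θ E ρ Λ : ℝ} {c : ℕ} {inj : ℕ → ℕ → ℝ}
    (hinj : InjectedRate C c θ inj) (hE : 0 ≤ E) (hθ : 0 ≤ θ) (hθ1 : θ < 1) (hρ : 0 ≤ ρ) (hρ1 : ρ < 1) (hΛ : 1 ≤ Λ)
    (h : MidDiscrepancyRate D g₀ Λ E ρ inj) : HasContinuumLimit (D.scheme g₀) :=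
  hasContinuumLimit_of_midMatching D hM g₀ hU (midMatching_of_midDiscrepancyRate D g₀ hinj hE hθ hθ1 hρ hρ1 hΛ h)

/-- THE SUPPLIER-LEVEL DATA OF THE FREE-LEVEL ROUTE, bundled: one-run geometric defects and a mid-level discrepancy rate under
an injected rate with ratios in `[0,1[` and a volume factor `Λ ≥ 1`. [folklore] -/
def MidRateTelescopeData (D : FiniteEpsData F G) (g₀ : ℕ → ℝ) : Prop :=
  UniformGeomDefect D g₀ ∧ ∃ (C θ E ρ Λ : ℝ) (c : ℕ) (inj : ℕ → ℕ → ℝ), InjectedRate C c θ inj ∧ 0 ≤ E ∧ 0 ≤ θ ∧ θ < 1 ∧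
    0 ≤ ρ ∧ ρ < 1 ∧ 1 ≤ Λ ∧ MidDiscrepancyRate D g₀ Λ E ρ inj

/-- `MidRateTelescopeData ⇒ MidLevelTelescopeData`. [folklore] -/
theorem midLevelTelescopeData_of_rate (D : FiniteEpsData F G) (g₀ : ℕ → ℝ) (h : MidRateTelescopeData D g₀) :
    MidLevelTelescopeData D g₀ := by
  obtain ⟨hU, C, θ, E, ρ, Λ, c, inj, hinj, hE, hθ, hθ1, hρ, hρ1, hΛ, hR⟩ := h
  exact ⟨hU, midMatching_of_midDiscrepancyRate D g₀ hinj hE hθ hθ1 hρ hρ1 hΛ hR⟩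

/-- **TARGET `ym4_torus_continuum_limit_exists` ⇐ one-run geometric defects + a mid-level discrepancy rate, under the cell's
prefix** (β-hypothesis `BetaPertHyp` and (B) explicit in `UnderHypotheses`). [folklore] -/
theorem ym4_torus_continuum_limit_exists_of_midRate [RegularGaugeGroup G] (D : FiniteEpsData F G)
    (hM : D.AvgMeasurable) (h : D.UnderHypotheses (BetaPertHyp D.βfun) fun g₀ => MidRateTelescopeData D g₀) :
    D.ym4_torus_continuum_limit_exists :=
  ym4_torus_continuum_limit_exists_of_midMatching D hM
    (FiniteEpsData.UnderHypotheses.mono (fun g₀ hg => midLevelTelescopeData_of_rate D g₀ hg) h)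

/-- … and the uniqueness target. [cite: MagnenRivasseauSeneor1993, p.326] -/
theorem ym4_torus_continuum_limit_unique_of_midRate [RegularGaugeGroup G] (D : FiniteEpsData F G)
    (hM : D.AvgMeasurable) (h : D.UnderHypotheses (BetaPertHyp D.βfun) fun g₀ => MidRateTelescopeData D g₀) :
    D.ym4_torus_continuum_limit_unique :=
  D.limit_unique_of_limit_exists (ym4_torus_continuum_limit_exists_of_midRate D hM h)

/-- PRINT-FAITHFUL FORM of the existence target from the supplier-level data. [cite: Balaban1987RG1, Thm 2 p.259] -/
theorem ym4_torus_continuum_limit_exists'_of_midRate [RegularGaugeGroup G] (D : FiniteEpsData F G)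
    (hM : D.AvgMeasurable)
    (h : D.UnderHypotheses (DagBinding.EndpointExistence D.C.toB12) fun g₀ => MidRateTelescopeData D g₀) :
    D.ym4_torus_continuum_limit_exists' :=
  ym4_torus_continuum_limit_exists'_of_midMatching D hM
    (FiniteEpsData.UnderHypotheses.mono (fun g₀ hg => midLevelTelescopeData_of_rate D g₀ hg) h)

end CellSupplier

/-! ### §6.3 The density-level venue at distance `m` from both ends: normalised level laws in the push-forward reading,
the relocation interface (Q-av), and the good/bad datum that delivers `MidDiscrepancyRate` -/

section Venue

variable {P : Params} {G : Type*} [GaugeGroup G] [MeasurableSpace G] [HaarData G]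

/-- `IsNormLaw p A μ`: the measure `μ` on `X` IS the normalised law `p·dV/∫p dV` of the level-`j` field pushed forward under
`A`, in the push-forward reading of the tree (`Setup.IsRT`): `∫ φ dμ = ∫dV p(V)·φ(A V) / ∫dV p(V)` for every bounded
measurable `φ`.  A HYPOTHESIS SHAPE on the pair (`p`, `μ`); inhabited by `normLaw` as soon as `p ≥ 0` is measurable with
`∫p > 0` (`isNormLaw_normLaw`) — properties print gives Bałaban's densities (products of exponentials and characteristic
functions) but the cell's data type `T4Continuum.FiniteEpsData` does not record. [folklore] -/
def IsNormLaw {j : ℕ} {X : Type*} [MeasurableSpace X] (p : Density P j G) (A : GaugeField P j G → X) (μ : Measure X) :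
    Prop :=
  ∀ φ : X → ℝ, Measurable φ → (∃ C : ℝ, ∀ x, |φ x| ≤ C) →
    ∫ x, φ x ∂μ = (∫ V, p V * φ (A V) ∂fieldMeasure P j G) / ∫ V, p V ∂fieldMeasure P j G

/-- A normalised law in the push-forward reading is a probability measure (test `φ = 1`; `∫p ≠ 0`). [folklore] -/
theorem IsNormLaw.isProbabilityMeasure {j : ℕ} {X : Type*} [MeasurableSpace X] {p : Density P j G}
    {A : GaugeField P j G → X} {μ : Measure X} (h : IsNormLaw p A μ) (hp : ∫ V, p V ∂fieldMeasure P j G ≠ 0) :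
    IsProbabilityMeasure μ := by
  have h1 := h (fun _ => (1 : ℝ)) measurable_const ⟨1, fun _ => by simp⟩
  simp only [mul_one, integral_const, smul_eq_mul, div_self hp] at h1
  refine ⟨(ENNReal.toReal_eq_one_iff (μ Set.univ)).mp ?_⟩
  rw [← measureReal_def]
  exact h1

/-- THE CANONICAL INHABITANT: `normLaw p A = (∫p)⁻¹ · A_*(p·dV)`. [folklore] -/
def normLaw {j : ℕ} {X : Type*} [MeasurableSpace X] (p : Density P j G) (A : GaugeField P j G → X) : Measure X :=
  ENNReal.ofReal (∫ V, p V ∂fieldMeasure P j G)⁻¹ •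
    ((fieldMeasure P j G).withDensity fun V => ENNReal.ofReal (p V)).map A

/-- For a measurable density `p ≥ 0` and a measurable `A`, `normLaw p A` is the normalised push-forward law in the
push-forward reading. [folklore] -/
theorem isNormLaw_normLaw {j : ℕ} {X : Type*} [MeasurableSpace X] {p : Density P j G} (hpm : Measurable p)
    (hp0 : ∀ V, 0 ≤ p V) {A : GaugeField P j G → X} (hA : Measurable A) : IsNormLaw p A (normLaw p A) := by
  intro φ hφ _
  rw [normLaw, integral_smul_measure, integral_map hA.aemeasurable hφ.aestronglyMeasurable,
    T4VarianceMatching.integral_withDensity_ofReal_mul hpm hp0,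
    ENNReal.toReal_ofReal (inv_nonneg.mpr (integral_nonneg hp0)), smul_eq_mul, div_eq_inv_mul]

end Venue

section CellVenue

open T4Continuum Missing T4CauchySum

variable {F : T4Family} {G : Type*} [GaugeGroup G] [MeasurableSpace G] [HaarData G]

/-- **THE RELOCATION INTERFACE — the record's question (Q-av) made a field** (hypothesis structure; NO instance asserted).
At distance `m` from their ends, run `k + m` is at level `k` of the `(k+m)`-th torus and run `k + 1 + m` at level `k + 1` of
the `(k+1+m)`-th torus: two lattices of the SAME size (spacing `L^{−m}` on the physical torus).  The interface asks for a
measurable identification `ι` of the second with the first under which the loop product pulled back `m` levels through run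
`k+1+m`'s averagings IS the loop product pulled back `m` levels through run `k+m`'s averagings (`fac`).  In Bałaban's scheme
this is the LEVEL-HOMOGENEITY of the averaging prescription and of the loop representatives ((0.11)–(0.12) of
[Balaban1987RG1] are one formula at every level); the cell's data type keeps `D.av K j` free run by run and level by level,
so a supplier must provide it (cf. `T4VarianceMatching.NestedFactorisation.nest`, the same identification one level from
the START of the runs). [folklore] -/
structure MidRelocation (D : FiniteEpsData F G) (Cs : List (ULoop F)) (k m : ℕ) where
  /-- run `k+1+m`'s level-`(k+1)` fields read as run `k+m`'s level-`k` fields -/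
  ι : GaugeField (F.P (k + 1 + m)) (k + 1) G → GaugeField (F.P (k + m)) k G
  measurable_ι : Measurable ι
  /-- the two pulled-back loop products are one function under `ι` -/
  fac : ∀ V, pullback (D.av (k + 1 + m)) (k + 1) m (prodLoop (k + 1 + m) Cs) V
    = pullback (D.av (k + m)) k m (prodLoop (k + m) Cs) (ι V)

/-- **THE (L^∞, L¹) PAIRING AT THE FREE LEVEL**: given the relocation, normalised level laws `μ` (run `k+m`, level `k`) and
`μ'` (run `k+1+m`, level `k+1`, transported by `ι`) on run `k+m`'s level-`k` lattice, and a good/bad density datum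
`μ' = g·μ`, `|g − 1| ≤ s` on `Gd`, `μ(Gdᶜ) ≤ w`, `μ'(Gdᶜ) ≤ w'` — then
`|midExpect (k+1+m) m − midExpect (k+m) m| ≤ s + w + w'` (the pulled-back loop product has `|·| ≤ 1`;
`T4VarianceMatching.integral_abs_sub_one_le_of_goodBad`, `abs_integral_mul_sub_integral_le_tv`, used by name).
`D.AvgMeasurable` makes the pulled-back weight measurable. [folklore] -/
theorem abs_midExpect_sub_le_of_goodBad [RegularGaugeGroup G] (D : FiniteEpsData F G) (hM : D.AvgMeasurable)
    (g₀ : ℕ → ℝ) {Cs : List (ULoop F)} {k m : ℕ} (R : MidRelocation D Cs k m)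
    {μ μ' : Measure (GaugeField (F.P (k + m)) k G)} (hμ : IsNormLaw (rho D (k + m) (g₀ (k + m)) k) id μ)
    (hμ' : IsNormLaw (rho D (k + 1 + m) (g₀ (k + 1 + m)) (k + 1)) R.ι μ')
    {g : GaugeField (F.P (k + m)) k G → ℝ} {Gd : Set (GaugeField (F.P (k + m)) k G)} {s w w' : ℝ}
    (hgm : Measurable g) (hg0 : ∀ V, 0 ≤ g V) (hgi : Integrable g μ)
    (hdens : μ' = μ.withDensity fun V => ENNReal.ofReal (g V)) (hGd : MeasurableSet Gd) (hs0 : 0 ≤ s)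
    (hs : ∀ V ∈ Gd, |g V - 1| ≤ s) (hw : μ.real Gdᶜ ≤ w) (hw' : ∫ V in Gdᶜ, g V ∂μ ≤ w') :
    |midExpect D g₀ (k + 1 + m) Cs m - midExpect D g₀ (k + m) Cs m| ≤ s + w + w' := by
  set W : GaugeField (F.P (k + m)) k G → ℝ := pullback (D.av (k + m)) k m (prodLoop (k + m) Cs) with hW
  have hWm : Measurable W := measurable_pullback (D.av (k + m)) (hM (k + m)) k m _ (measurable_prodLoop (k + m) Cs)
  have hWb : ∀ V, |W V| ≤ 1 := abs_pullback_le (D.av (k + m)) k m _ (abs_prodLoop_le_one (k + m) Cs)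
  haveI : IsProbabilityMeasure μ :=
    hμ.isProbabilityMeasure (ne_of_gt (integral_rho_level_pos D (k + m) (g₀ (k + m)) (Nat.le_add_right k m)))
  haveI : IsProbabilityMeasure (μ.withDensity fun V => ENNReal.ofReal (g V)) := by
    rw [← hdens]
    exact hμ'.isProbabilityMeasure (ne_of_gt (integral_rho_level_pos D (k + 1 + m) (g₀ (k + 1 + m))
      (Nat.le_add_right (k + 1) m)))
  have e1 : midExpect D g₀ (k + m) Cs m = ∫ V, W V ∂μ := by
    rw [midExpect_add_eq', hμ W hWm ⟨1, hWb⟩]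
    rfl
  have e2 : midExpect D g₀ (k + 1 + m) Cs m = ∫ V, W V ∂μ' := by
    rw [midExpect_add_eq', hμ' W hWm ⟨1, hWb⟩]
    have : (fun V => rho D (k + 1 + m) (g₀ (k + 1 + m)) (k + 1) V
        * pullback (D.av (k + 1 + m)) (k + 1) m (prodLoop (k + 1 + m) Cs) V)
        = fun V => rho D (k + 1 + m) (g₀ (k + 1 + m)) (k + 1) V * W (R.ι V) := funext fun V => by rw [R.fac V]
    rw [this]
  have hWi : Integrable W μ := T4VarianceMatching.integrable_of_abs_le μ hWm hWb
  have hWgi : Integrable (fun V => W V * g V) μ :=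
    hgi.bdd_mul hWm.aestronglyMeasurable (ae_of_all _ fun V => by rw [Real.norm_eq_abs]; exact hWb V)
  have hg1 : ∫ V, g V ∂μ = 1 := T4VarianceMatching.integral_density_eq_one hgm hg0
  rw [e1, e2, hdens, T4VarianceMatching.integral_withDensity_ofReal_mul hgm hg0]
  have hcomm : ∫ V, g V * W V ∂μ = ∫ V, W V * g V ∂μ := integral_congr_ae (ae_of_all _ fun V => mul_comm _ _)
  rw [hcomm]
  calc |∫ V, W V * g V ∂μ - ∫ V, W V ∂μ| ≤ 1 * ∫ V, |g V - 1| ∂μ :=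
        T4VarianceMatching.abs_integral_mul_sub_integral_le_tv (m := 0) (R := 1) hWi hgi hWgi hg1 fun V => by
          rw [sub_zero]; exact hWb V
    _ ≤ 1 * (s + w + w') := mul_le_mul_of_nonneg_left
        (T4VarianceMatching.integral_abs_sub_one_le_of_goodBad hg0 hgi hGd hs0 hs hw hw') zero_le_one
    _ = s + w + w' := one_mul _

/-- HYPOTHESIS SHAPE — THE DENSITY-LEVEL DATUM AT THE FREE LEVEL (NOT PRINTED, never asserted; the undressed U5 matching of
the cell at distance `m` from both ends, in the (L^∞, L¹) currency of `T4VarianceMatching.UnitFactorisation.EffDensityRate`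
relocated from the unit lattice to level `K − m`): per string there is `V ≥ 0` such that for all `k, m` the relocation
interface at `(k, m)` is inhabited, the two normalised level laws exist in the push-forward reading, and `μ' = g·μ` with a
good/bad datum of total `s + w + w' ≤ V·Λ^m·deltaAt E ρ inj (k+m) k` — the volume `Λ^m` of the level-`k` lattice times the
runs' injected discrepancy accumulated at level `k`.  CONTAINS (as `EffDensityRate` does, audit C-t4r3-1): the absolute
continuity `μ' ≪ μ`, and the requirement that the good set carry all but a summable weight of BOTH laws — so old large-field
regions must lie inside it. [folklore] -/
def MidGoodBadRate (D : FiniteEpsData F G) (g₀ : ℕ → ℝ) (Λ E ρ : ℝ) (inj : ℕ → ℕ → ℝ) : Prop :=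
  ∀ Cs : List (ULoop F), ∃ V : ℝ, 0 ≤ V ∧ ∀ k m : ℕ,
    ∃ (R : MidRelocation D Cs k m) (μ μ' : Measure (GaugeField (F.P (k + m)) k G))
      (g : GaugeField (F.P (k + m)) k G → ℝ) (Gd : Set (GaugeField (F.P (k + m)) k G)) (s w w' : ℝ),
      IsNormLaw (rho D (k + m) (g₀ (k + m)) k) id μ ∧
      IsNormLaw (rho D (k + 1 + m) (g₀ (k + 1 + m)) (k + 1)) R.ι μ' ∧
      Measurable g ∧ (∀ V, 0 ≤ g V) ∧ Integrable g μ ∧ μ' = μ.withDensity (fun V => ENNReal.ofReal (g V)) ∧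
      MeasurableSet Gd ∧ 0 ≤ s ∧ (∀ V ∈ Gd, |g V - 1| ≤ s) ∧ μ.real Gdᶜ ≤ w ∧ ∫ V in Gdᶜ, g V ∂μ ≤ w' ∧
      s + w + w' ≤ V * Λ ^ m * deltaAt E ρ inj (k + m) k

/-- **THE DENSITY-LEVEL DATUM ⇒ `MidDiscrepancyRate`** (reindex `K = k + m`, `K + 1 = k + 1 + m`, `K − m = k`;
`abs_midExpect_sub_le_of_goodBad`). [folklore] -/
theorem midDiscrepancyRate_of_goodBad [RegularGaugeGroup G] (D : FiniteEpsData F G) (hM : D.AvgMeasurable)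
    (g₀ : ℕ → ℝ) {Λ E ρ : ℝ} {inj : ℕ → ℕ → ℝ} (h : MidGoodBadRate D g₀ Λ E ρ inj) :
    MidDiscrepancyRate D g₀ Λ E ρ inj := by
  intro Cs
  obtain ⟨V, hV, hkm⟩ := h Cs
  refine ⟨V, hV, fun K m hm => ?_⟩
  obtain ⟨k, rfl⟩ := Nat.exists_eq_add_of_le' hm
  obtain ⟨R, μ, μ', g, Gd, s, w, w', hμ, hμ', hgm, hg0, hgi, hdens, hGd, hs0, hs, hw, hw', hle⟩ := hkm k m
  rw [show k + m + 1 = k + 1 + m from Nat.add_right_comm k m 1, Nat.add_sub_cancel]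
  exact (abs_midExpect_sub_le_of_goodBad D hM g₀ R hμ hμ' hgm hg0 hgi hdens hGd hs0 hs hw hw').trans hle

/-- **EXISTENCE FROM ONE-RUN SIZES AND THE DENSITY-LEVEL DATUM AT THE FREE LEVEL.** [folklore] -/
theorem hasContinuumLimit_of_goodBad [RegularGaugeGroup G] (D : FiniteEpsData F G) (hM : D.AvgMeasurable)
    (g₀ : ℕ → ℝ) (hU : UniformGeomDefect D g₀) {C θ E ρ Λ : ℝ} {c : ℕ} {inj : ℕ → ℕ → ℝ}
    (hinj : InjectedRate C c θ inj) (hE : 0 ≤ E) (hθ : 0 ≤ θ) (hθ1 : θ < 1) (hρ : 0 ≤ ρ) (hρ1 : ρ < 1) (hΛ : 1 ≤ Λ)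
    (h : MidGoodBadRate D g₀ Λ E ρ inj) : HasContinuumLimit (D.scheme g₀) :=
  hasContinuumLimit_of_midDiscrepancyRate D hM g₀ hU hinj hE hθ hθ1 hρ hρ1 hΛ (midDiscrepancyRate_of_goodBad D hM g₀ h)

end CellVenue

/-! ### §6.4 (v3.1) (Q-av) reduced to a SCALE LADDER: level-wise identifications intertwining the two runs' averagings, plus
loop compatibility at the unit level, give the relocation interface at every `(Cs, k, m)` -/

section Ladder

variable {P P' : Params} {G : Type*} [GaugeGroup G] [MeasurableSpace G]

/-- **A SCALE LADDER between two parameter sets** (hypothesis structure; NO instance asserted): for every pair of levels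
`j' = j + 1` a measurable identification `ι j j'` of the level-`j'` fields of `P'` with the level-`j` fields of `P`,
INTERTWINING the averagings — `avg_j ∘ ι_{j,j'} = ι_{j+1,j'+1} ∘ avg'_{j'}` (`step`).  The level indices carry explicit
equations (`j' = j + 1`) so that every instance is stated on the nose, without casts.  Reading, for Bałaban's runs at
spacings `L^{−K}` (`P = F.P K`) and `L^{−K−1}` (`P' = F.P (K+1)`): level `j+1` of the finer run and level `j` of the coarser
run are lattices of the same size, and ONE block-averaging formula ((0.11)–(0.12) of [Balaban1987RG1] p.253, tree-quoted in
`Setup`/`T4Continuum`; v3.2 DOCFIX of XREAD C-ref6-126 V1, bib key) acts on both — level-homogeneity; the cell's data type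
does not record it. [folklore] -/
structure ScaleLadder (P P' : Params) (av : ∀ j, Averaging P j G) (av' : ∀ j, Averaging P' j G) where
  /-- level `j'` of `P'` read as level `j` of `P`, for `j' = j + 1` -/
  ι : ∀ j j' : ℕ, j' = j + 1 → GaugeField P' j' G → GaugeField P j G
  measurable_ι : ∀ (j j' : ℕ) (h : j' = j + 1), Measurable (ι j j' h)
  /-- the averagings are intertwined -/
  step : ∀ (j j' : ℕ) (h : j' = j + 1) (h₁ : j' + 1 = j + 1 + 1) (V : GaugeField P' j' G),
    (av j).avg (ι j j' h V) = ι (j + 1) (j' + 1) h₁ ((av' j').avg V)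

variable {av : ∀ j, Averaging P j G} {av' : ∀ j, Averaging P' j G}

/-- **PULLBACKS ALONG A LADDER AGREE**: if two weights at the tops agree under the top identification, their pullbacks by
`m` levels agree under the bottom identification — induction on `m`, one `step` per level. [folklore] -/
theorem ScaleLadder.pullback_eq (Lad : ScaleLadder P P' av av') :
    ∀ (m k k' : ℕ) (hk : k' = k + 1) (hkm : k' + m = k + m + 1) (f : GaugeField P (k + m) G → ℝ)
      (f' : GaugeField P' (k' + m) G → ℝ), (∀ V, f' V = f (Lad.ι (k + m) (k' + m) hkm V)) →
      ∀ V, pullback av' k' m f' V = pullback av k m f (Lad.ι k k' hk V)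
  | 0, _, _, _, _, _, _, hf, V => hf V
  | m + 1, k, k', hk, hkm, f, f', hf, V =>
    ScaleLadder.pullback_eq Lad m k k' hk (by omega) (fun U => f ((av (k + m)).avg U))
      (fun U => f' ((av' (k' + m)).avg U))
      (fun U => (hf _).trans (congrArg f (Lad.step (k + m) (k' + m) (by omega) (by omega) U)).symm) V

end Ladder

section CellLadder

open T4Continuum Missing T4CauchySum

variable {F : T4Family} {G : Type*} [GaugeGroup G] [MeasurableSpace G] [HaarData G]

/-- **A RUN LADDER for the cell's data** (hypothesis structure; NO instance asserted): for every pair of consecutive runs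
`K' = K + 1` a scale ladder between the `K`-th and the `K'`-th torus intertwining the runs' averagings `D.av K`, `D.av K'`,
whose unit-level identification preserves the holonomy of every represented loop (`loop`: the loop representatives
`ULoop.atLevel K`, `atLevel K'` on the two unit lattices are one loop under `ι K K'`).  This is (Q-av) of the record in its
natural form — the same datum as `T4VarianceMatching.NestedFactorisation.nest` one level from the START of the runs, here
for ALL levels. [folklore] -/
structure RunLadder (D : FiniteEpsData F G) where
  /-- the ladder between runs `K` and `K' = K + 1` -/
  lad : ∀ K K' : ℕ, K' = K + 1 → ScaleLadder (F.P K) (F.P K') (D.av K) (D.av K')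
  /-- unit-level loop compatibility -/
  loop : ∀ (K K' : ℕ) (h : K' = K + 1) (V : GaugeField (F.P K') K' G) (C : ULoop F),
    loopAt ((lad K K' h).ι K K' h V) (C.1.atLevel K) = loopAt V (C.1.atLevel K')

/-- Loop products are compatible at the unit level along a run ladder. [folklore] -/
theorem RunLadder.prodLoop_eq {D : FiniteEpsData F G} (R : RunLadder D) (K K' : ℕ) (h : K' = K + 1)
    (Cs : List (ULoop F)) (V : GaugeField (F.P K') K' G) :
    prodLoop K' Cs V = prodLoop K Cs ((R.lad K K' h).ι K K' h V) := by
  unfold prodLoop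
  congr 1
  exact List.map_congr_left fun C _ => (R.loop K K' h V C).symm

/-- **(Q-av) ⇐ A RUN LADDER**: a run ladder inhabits the relocation interface `MidRelocation D Cs k m` at EVERY string,
level and distance (`ι := (lad (k+m) (k+1+m)).ι k (k+1)`, `fac` by `ScaleLadder.pullback_eq` from `prodLoop_eq`).
[folklore] -/
def RunLadder.midRelocation {D : FiniteEpsData F G} (R : RunLadder D) (Cs : List (ULoop F)) (k m : ℕ) :
    MidRelocation D Cs k m where
  ι := (R.lad (k + m) (k + 1 + m) (by omega)).ι k (k + 1) rfl
  measurable_ι := (R.lad (k + m) (k + 1 + m) (by omega)).measurable_ι k (k + 1) rfl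
  fac := ScaleLadder.pullback_eq (R.lad (k + m) (k + 1 + m) (by omega)) m k (k + 1) rfl (by omega)
    (prodLoop (k + m) Cs) (prodLoop (k + 1 + m) Cs) (fun V => R.prodLoop_eq (k + m) (k + 1 + m) (by omega) Cs V)

/-- HYPOTHESIS SHAPE — THE GOOD/BAD DATUM ALONG A GIVEN RUN LADDER (NOT PRINTED, never asserted): as `MidGoodBadRate`, with
the relocation FIXED to the ladder's (so a supplier proves level-homogeneity ONCE, as a `RunLadder`, and then owes only
measures and densities). [folklore] -/
def LadderGoodBadRate (D : FiniteEpsData F G) (R : RunLadder D) (g₀ : ℕ → ℝ) (Λ E ρ : ℝ) (inj : ℕ → ℕ → ℝ) : Prop :=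
  ∀ Cs : List (ULoop F), ∃ V : ℝ, 0 ≤ V ∧ ∀ k m : ℕ,
    ∃ (μ μ' : Measure (GaugeField (F.P (k + m)) k G))
      (g : GaugeField (F.P (k + m)) k G → ℝ) (Gd : Set (GaugeField (F.P (k + m)) k G)) (s w w' : ℝ),
      IsNormLaw (rho D (k + m) (g₀ (k + m)) k) id μ ∧
      IsNormLaw (rho D (k + 1 + m) (g₀ (k + 1 + m)) (k + 1)) (R.midRelocation Cs k m).ι μ' ∧
      Measurable g ∧ (∀ V, 0 ≤ g V) ∧ Integrable g μ ∧ μ' = μ.withDensity (fun V => ENNReal.ofReal (g V)) ∧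
      MeasurableSet Gd ∧ 0 ≤ s ∧ (∀ V ∈ Gd, |g V - 1| ≤ s) ∧ μ.real Gdᶜ ≤ w ∧ ∫ V in Gdᶜ, g V ∂μ ≤ w' ∧
      s + w + w' ≤ V * Λ ^ m * deltaAt E ρ inj (k + m) k

/-- `LadderGoodBadRate ⇒ MidGoodBadRate` (the ladder supplies the relocation). [folklore] -/
theorem midGoodBadRate_of_ladder (D : FiniteEpsData F G) (R : RunLadder D) (g₀ : ℕ → ℝ) {Λ E ρ : ℝ}
    {inj : ℕ → ℕ → ℝ} (h : LadderGoodBadRate D R g₀ Λ E ρ inj) : MidGoodBadRate D g₀ Λ E ρ inj := by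
  intro Cs
  obtain ⟨V, hV, hkm⟩ := h Cs
  refine ⟨V, hV, fun k m => ?_⟩
  obtain ⟨μ, μ', g, Gd, s, w, w', hμ, hμ', hgm, hg0, hgi, hdens, hGd, hs0, hs, hw, hw', hle⟩ := hkm k m
  exact ⟨R.midRelocation Cs k m, μ, μ', g, Gd, s, w, w', hμ, hμ', hgm, hg0, hgi, hdens, hGd, hs0, hs, hw, hw', hle⟩

/-- **EXISTENCE FROM ONE-RUN SIZES, A RUN LADDER AND THE GOOD/BAD DATUM ALONG IT.** [folklore] -/
theorem hasContinuumLimit_of_ladder [RegularGaugeGroup G] (D : FiniteEpsData F G) (hM : D.AvgMeasurable)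
    (R : RunLadder D) (g₀ : ℕ → ℝ) (hU : UniformGeomDefect D g₀) {C θ E ρ Λ : ℝ} {c : ℕ} {inj : ℕ → ℕ → ℝ}
    (hinj : InjectedRate C c θ inj) (hE : 0 ≤ E) (hθ : 0 ≤ θ) (hθ1 : θ < 1) (hρ : 0 ≤ ρ) (hρ1 : ρ < 1) (hΛ : 1 ≤ Λ)
    (h : LadderGoodBadRate D R g₀ Λ E ρ inj) : HasContinuumLimit (D.scheme g₀) :=
  hasContinuumLimit_of_goodBad D hM g₀ hU hinj hE hθ hθ1 hρ hρ1 hΛ (midGoodBadRate_of_ladder D R g₀ h)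

end CellLadder

end Literature.MathematicalPhysics.QuantumFieldTheory.Balaban1983to89.T4ObservableTelescopeTwoRun
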